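import Summits.AtomisticToContinuum.HydrodynamicLimit.Theorems.TwoClocksEquilibriumFastWindowLDReductionBounded
import Summits.AtomisticToContinuum.HydrodynamicLimit.Theorems.TwoClocksEquilibriumFastWindowLDBirthLipschitzReduction
import Summits.AtomisticToContinuum.HydrodynamicLimit.Theses.TwoClocks
import Literature.Analysis.UnboundedOperators.LinearizedBoltzmann

/-!
# Skeleton of the line `birth` (= `clamped-corrector-innovations`), rev 4 — symmetric linear streams + run census
# for the crux `TwoClocks.EquilibriumFastWindowLD` (stmt-AtomisticToContinuum-14440)

Rev 1: the registrar's birth certificate (planner-skel-stmt-AtomisticToContinuum-14440-0, 2026-08-17, BC3) of the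
only triage-passed idea `clamped-corrector-innovations`; rev 2 (lead a1, same day): pair-clamped streams after the
CORRECTOR LOG-RESONANCE finding below; rev 3 (lead a1, same day): rev 2's on–off census charged every on–off record
the full corrector size `(1+s)log s` and is FALSE by the Newton-cradle HANDOVER CHAIN (a fast packet hopping along a
cheap row of alternating on/off spheres is charged `≍ sτ/σ` times `s log s`: gain `βs²log s/σ³` vs cost `O(sτ log)`),
although the true remainder telescopes along the packet; rev 3 therefore (i) keeps the corrector values UNCLAMPED
(`S = Σ_i ĝ(z_i)`: no switch-off boundary terms at all), (ii) prices the PAIR increments of non-retained collisions by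
the purely KINEMATIC functional `min(kick, ‖u_⊥‖)·(1+log(1+speeds))` (both matchings of the outgoing to the incoming
pair), which sees exchange-like and grazing collisions as small — this needs a velocity-LIPSCHITZ corrector, hence
(iii) the transfer now targets the Lipschitz sub-class `W_Lip` with the tilt range FREE of the Lipschitz constant, and
a new static stub `W_Lip → W` (density + Hölder, landed devices) closes the gap to the landed normal form; rev 4 (lead a1 after wave 1,
same day): (N1, wave-1 T-audit) rev 3's D₂ is FALSE for the log-linear class (a collision-free fast ON sphere's local Enskog compensator accrues
`πYCσ²s²τ log s` at void cost `πYσ²sτ + s²/(2θ₀)` ⇒ pressure/N ≥ (πβCY/2)log N at `s² = N`) — fixed by SYMMETRIC pair test functions of LINEAR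
growth, which is all the transfer needs because (N2) pair clamping makes both streams depend on `h, m` only through their fst/snd-symmetrisations
and the symmetrised corrector data `½(PI_ĝ − E_ω PI_ĝ)`, `½E_ω PI_ĝ` (`PI_ĝ` = pair increment) are LINEAR pointwise — the log multiplies the exact
momentum invariant (radial log-modulus `|Φ(r) − Φ(S)| ≤ (4C'/π)log(S/r) + O(C')`); (N3) rev 3's kinematic D₄ is FALSE (exploding jammed blob:
pressure/N ≍ N^{1/3}; jammed ring wrapping 𝕋³ and ring-cradle laps at fixed N) and is replaced by the RUN CENSUS: the non-retained remainder
telescopes per particle along maximal runs of consecutive non-retained own records (velocity constant between own records), so only run BOUNDARIES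
are charged, by sizes `Ψ(r) = (1+r)(1+log(1+r))`; typed here in its dominating CONTAMINATION form (plain `collisionSum`s); finite for all
parameters pathwise (`≤ (2Vτ+4)Σ_iΨ(√(2E))`); tilt `∃λ₀(V)` after `V` (the debris-double-row defect factory gives threshold `λ* ≈ 6σ³/V`);
(N4) v-Lipschitz of `G` is never used, x-Lipschitz only for transport; the static stub L `W_Lip → W` LANDED (p149711) and is used as a theorem;
rev 5 (lead a1, own audit of D₂): the contact value of the compensator is CAPPED at `η ≤ 8σ³` (jammed-cluster pocket witness, see D₂). Namespace `…Cruxes.EquilibriumFastWindowLD.Birth`; card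
`Lines/birth.md` (+ the lead's `PICKED.md`, `Negative-notes/corrector-log-resonance.md`).

THE LINE. Invert the linearised hard-sphere operator ON the observable: for `G` in the bounded class `𝒢(C')`
(continuous, `|G| ≤ C'(1+|v|²)`, compact `v`-support, `M_{1,u₀,θ₀}`-orthogonal at every `x` to `1, v_j, |v|²`
— the crux is EQUIVALENT to its restriction to this class with a class-uniform tilt range, `W`, by the landed
`FastWindowRG.EquilibriumFastWindowLD_of_boundedWindowLD` p125773 / `boundedWindowLD_iff_…` p135606) take a
Chapman–Enskog pre-image `ĝ(x,·)`, `L_{θ₀,u₀} ĝ = −G` (solvable iff the three orthogonality clauses —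
Disproof (a.1)–(a.3) enter HERE). Along a good orbit the clamped corrector sum `S(t) = Σ_i ω_i(t) ĝ(z_i(t))`
— UNCLAMPED sum `S(t) = Σ_i ĝ(z_i(t))` — obeys an EXACT pathwise identity (★): chain rule between collisions +
Hoeffding decomposition of a local Enskog compensator over ON pairs + `Lĝ = −G`; the running clamps only SELECT which
collisions are compensated: after `× β/w` the retained (both-on) collisions sit in PAIR-CLAMPED INNOVATION STREAMS at
the CLT coupling `β/(Yτσ²)` (`σ > 0`, Disproof (a.0), enters through this clock) — the angle stream (D₁) and the
partner/rate stream against the local Enskog compensator (D₂), both fed with SYMMETRISED, hence LINEAR, corrector data —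
while the non-retained collisions telescope per particle along runs and are priced by the run/contamination census D₄;
switched-off particles in the target are priced by the equilibrium census D₃; the rest is landed statics; the Lipschitz
class is removed by the landed L.

WHY REV 2 (lead's finding, `Negative-notes/corrector-log-resonance.md`). Rev 1 (and the original card, and
triage finding (1)) assumed a pre-image of LINEAR velocity growth, `|ĝ| ≤ cC'(1+|v|)` "modulo collision
invariants". That is FALSE in the `ℓ = 1` sector: power counting of `L` on `r^α Y_ℓ(v̂)` gives
`L(r^αY_ℓ) ≈ π(λ_ℓ(α)−1) r^{α+1} Y_ℓ`, `λ_ℓ(α) = ∫₀¹ 2c [(1−c²)^{α/2}P_ℓ(√(1−c²)) + c^α P_ℓ(c)] dc`,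
`λ₀ = 4/(α+2)` (root `α = 2`: energy), `λ₁ = 4/(α+3)` (root `α = 1`: MOMENTUM). Quadratic admissible `ℓ = 1`
data (e.g. `v_j(|v| − c)`, `c = E[v_j²|v|]`, which IS `⊥ 1, v, |v|²`) are resonant: every pre-image grows like
`(4g₂/π) |v| log|v| v̂_j` (`λ₁'(1) = −1/4`; equivalently `L(v_z log|v|) = −(π/4)|v| v_z + O(|v|)`, the fast-particle
/ Lorentz limit of `L`: scatterers at rest, `c²` uniform), so no uniform linear bound exists on the truncated
class either (`≍ ½ log R`). With a `|v| log|v|` corrector the SINGLE-clamped streams of rev 1 have INFINITE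
exponential moments at every `β ≠ 0` (a fast particle of speed `s`, switched off by the count clamp after `Vτ`
grazes in a tuned tube, keeps grazing ON particles whose records carry `−E_ω[Δĝ] ≈ −½ s log s` coherently,
`≍ σ²sτ` times: gain `≍ β s² log s` against Gaussian cost `s²/(2θ₀)` + tube cost `O(sτ)`). PAIR clamping — a
record is kept iff BOTH particles are on before the collision — removes exactly this channel: the two records of
one collision carry `±½ s log s` and are kept or dropped TOGETHER, and their sum is `O(s)` by the very resonance
(`E_ω[Δ(ĝ_i+ĝ_j)] = κ-term`, `κ = −1/4`). What pair clamping moves out of the streams — the actual increments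
`Δĝ_j` of an ON particle hit by an OFF one, and the post-collisional corrector value of a particle switched off
at an on–on collision — is bounded pathwise by `cC'·ψ(c)`, `ψ(c) = (1+|v⁻|+|v⁺|)(1+log(1+|v⁻|+|v⁺|))` of the ON
particle's own record; rev 2 priced it by speeds (false: handover chains); rev 3 keeps corrector values unclamped so
that only PAIR increments `ĝ(v_i')+ĝ(v_j')−ĝ(v_i)−ĝ(v_j)` of non-retained collisions remain, bounded by
`2·Lip(ĝ)·min(‖v_i'−v_i‖, ‖v_i'−v_j‖) = 2 Lip·min(kick, ‖u_⊥‖)` (the two matchings; exchange-like hops and grazes are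
small) plus the `x_i/x_j` mismatch `ε_N‖∇ₓĝ‖`, i.e. by the kinematic functional of D₄ times constants of `ĝ` that sit
(rev 3; dead) — rev 4 needs no pair increments at all. So rev 4 = rev 1 with: pair weights `ω_fst ω_snd` in D₁/D₂ (ON
partners in the D₂ compensator, contact value at the TOTAL local density), D₁ over the log-linear class as registered in
rev 2 (finite: wave-1 audit; contains the symmetric linear data T feeds), D₂ over SYMMETRIC pair functions of LINEAR growth,
the run/contamination census D₄ (`∃ λ₀(V)`), the transfer T: D₁ → D₂ → D₃ → D₄ → `W_Lip` with a corrector of growth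
`Ψ(v) = (1+|v|)(1+log(1+|v|))` whose ℓ=1 profiles have the radial log-modulus (T1–T2: OPEN analysis, the honest residue;
the tree's weighted-sup-norm scheme stops at `(1+|v|²)^{1+}`), and the LANDED static L: `W_Lip → W`.

STUBS (5 open + 1 landed; `sorry` only inside the five `stub_*`): `stub_angleInnovationPressure` (D₁),
`stub_partnerInnovationPressure` (D₂, symmetric linear; hardest), `stub_activityCensus` (D₃, verbatim rev 1),
`stub_runCensus` (D₄, contamination form, `∃ λ₀(V)`), `stub_correctorTransfer` (T: D₁ → D₂ → D₃ → D₄ → W_Lip), and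
`stub_lipschitzReduction` (L: W_Lip → W) = the LANDED `Theorems.ClampedCorrectorBirth.stub_lipschitzReduction` (p149711;
helpers p148725 dual family, p148811 Lipschitz approximation). Other wave-1 landings (`--supports`): p147828
`ccb1_collisionSum_swap`, p147838 `ccb1_norm_preVel_le` (pre-velocity ledger), p147965 record matchings (Pythagoras of
the two matchings), p148265 census truncation (`X(Q) → D₃`). COMPOSITION: `EquilibriumFastWindowLD_of :=
EquilibriumFastWindowLD_of_boundedWindowLD (stub_lipschitzReduction (stub_correctorTransfer stub_angleInnovationPressure
stub_partnerInnovationPressure stub_activityCensus stub_runCensus))` — BY NAME through the landed reduction;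
`EquilibriumFastWindowLD_of_statements` is the same proof over the six statements as hypotheses.

DISPROOF USED (`Disproof.lean` v1.3; conclusive parts landed under `Theorems/EquilibriumFastWindowLD/Negative/`):
(a.0) `σ > 0` — at T through the clock `Yσ²(N+1)^{1/3}`; (a.1)–(a.3) orthogonality — at T (solvability of
`Lĝ = −G`); (b.2)/(c.2) β-ceiling / no `F`-uniform `β₀` — `β₁(C') ∝ 1/C'`, uniform only over `𝒢(C')`;
`-- Targets` empty; no stub is an instance of a landed Negative lemma. Quantifier discipline kept from rev 1:
`V` before `β₀` in D₁/D₂ (blob/cage: gain `≤ βCV/σ²` per member, `τ`-free); census smallness from `τ → ∞` at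
FIXED `V` (fast spheres thermalise in `O(log s)` collisions; budget speed `Vτ/σ` costs `∝ τ²`) so that T fixes
`V`, hence `β₀(V)`, before `ε`; `κ₀(ε)` and `Y(η^loc)` in D₂ (fixed-`κ` / global / `Y(σ³)` versions are false).
-/

noncomputable section

open MeasureTheory
open scoped ENNReal BigOperators

namespace Summit.AtomisticToContinuum.HydrodynamicLimit.Cruxes.EquilibriumFastWindowLD.Birth

open Literature.Analysis.FluidPDE Literature.MathematicalPhysics.KineticTheory
open Summit.AtomisticToContinuum.HydrodynamicLimit.Theorems.FastWindowRG
  (EquilibriumFastWindowLD_of_boundedWindowLD)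

/-! ## The six registered stubs (rev 5: pair-clamped streams, symmetric linear partner class with CAPPED contact value, run/contamination census, Lipschitz class — L landed)

Frame of the crux throughout: universal `σ₀`; constants `a₀, θ₀ > 0`, `u₀`; canonical Gibbs law
`P = G_N = localGibbsLaw σ a₀ u₀ θ₀ N (Φ N)` (constant profiles, flow-invariant); kinetic window
`w = τ (N+1)^{-1/3}` (`≍ τσ²√θ₀` mean free times); collision records of the orbit of `z` under `Φ N`
are ORDERED (each collision appears once with each partner as `fst`), read off the post-collisional
configuration (`HardSphereCollisionRecord.ofConfig`). Running one-particle clamp of particle `i` at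
time `t` (PREDICTABLE: collisions of `i` with times in `(0, t)`, the current one excluded):
activity `act_i(t) = (σ/τ) Σ ‖v_i⁺ − v_i⁻‖ ≤ V` and count `cnt_i(t) ≤ V·τ`; `ω_i(t) ∈ {0, 1}`; the
CLOSED-interval status `ω'_i(t)` (records in `(0, t]`, the current one included) is the status just
after `t`. Streams are PAIR-CLAMPED: a record `c` at time `t_c` is retained iff BOTH particles are on
before the collision, weight `ω_fst(t_c) ω_snd(t_c)`. -/

/-- **D₁ — PAIR-CLAMPED ANGLE-INNOVATION PRESSURE** (dynamical). For every continuous pair test function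
`h x (v, v_*) (v', v_*')` of LOG-LINEAR growth `|h| ≤ C(1+‖v‖+‖v_*‖)(1+log(1+‖v‖+‖v_*‖))` which is
KINEMATICALLY CENTRED — for every incoming pair its hard-sphere-flux-weighted average over the impact
direction vanishes, `∫ ((v−v_*)·n)₊ h x p (collide n p) dn = 0` (uniform impact parameter ⇒ the exact Palm
centring under `G_N`; model: particle `fst`'s own corrector increment minus its mean given the incoming pair)
— the PAIR-clamped collision sum `Σ_c ω_fst(t_c) ω_snd(t_c) h(x_fst, (v_fst⁻, v_snd⁻), (v_fst⁺, v_snd⁺))` over the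
window has per-particle pressure `≤ ε` at the CLT coupling `β/(τσ²)` once `τ ≥ τ₀`, uniformly in `N`, with
CLASS-UNIFORM thresholds `∀ C ≥ 0 ∃ V₀ ∀ V ≥ V₀ ∃ β₀ ∀ |β| ≤ β₀ ∀ h`. The pair weight is PREDICTABLE (both
statuses read off records strictly before `t_c`), so retained increments stay exactly centred. Finiteness is
never the issue (rev-2/3 check with the log class): a retained record has both particles on, each on-particle
has `≤ Vτ` records as `fst` and `≤ Vτ` as `snd`, speeds while on `≤ |v(0)| + Vτ/σ`, so
`|coupling × sum| ≤ (2βCV/σ²) Σ_i (1 + |v_i(0)| + Vτ/σ)(1 + log(…))` — Gaussian-integrable; the single-clamp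
divergence of rev 1 for the log class (a switched-off fast grazer charging ON partners `−½ s log s` per record,
`≍ σ²sτ` times) is gone because such records are dropped with their twins. Why it might fail: a tilt family
with bounded activity and count for BOTH partners but a coherent angle bias `≫ √K_τ` per particle (grazing
corridors of mutually-on particles; shear-aligned cages just below the clamps); the asymmetric test functions
rewarding the faster `fst` (`+½ s log s` per tuned graze, `≤ Vτ` of them: gain `(βV/2σ²) s log s`, sub-Gaussian
— finite, and an LD loser as `τ → ∞`).
[sources: BGSSCPAM2023 = arXiv:2012.03813 Thm 1.1; Spohn1991 §I.8; KipnisLandim1999 App. 1 §6] -/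
theorem stub_angleInnovationPressure :
    ∃ σ₀ : ℝ, 0 < σ₀ ∧ ∀ (a₀ θ₀ : ℝ) (u₀ : V3), 0 < a₀ → 0 < θ₀ → ∀ σ : ℝ, 0 < σ → σ < σ₀ →
      ∀ Φ : (N : ℕ) → HardSphereFlow (Torus.geometry (Fin 3)) (hsDiameter σ N) (N + 1),
      ∀ C : ℝ, 0 ≤ C →
        ∃ V₀ : ℝ, 0 < V₀ ∧ ∀ V : ℝ, V₀ ≤ V → ∃ β₀ : ℝ, 0 < β₀ ∧ ∀ β : ℝ, |β| ≤ β₀ →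
        ∀ h : T3 → V3 × V3 → V3 × V3 → ℝ,
          Continuous (fun q : T3 × (V3 × V3) × (V3 × V3) => h q.1 q.2.1 q.2.2) →
          (∀ x p p', |h x p p'| ≤
              C * (1 + ‖p.1‖ + ‖p.2‖) * (1 + Real.log (1 + ‖p.1‖ + ‖p.2‖))) →
          (∀ (x : T3) (p : V3 × V3),
            ∫ n, hardSphereKernel p n * h x p (collide n p) ∂sphereMeasure = 0) →
          ∀ ε : ℝ, 0 < ε → ∃ τ₀ : ℝ, 0 < τ₀ ∧ ∀ τ : ℝ, τ₀ ≤ τ → ∃ N₀ : ℕ, ∀ N : ℕ, N₀ ≤ N →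
            (let w : ℝ := τ * ((N : ℝ) + 1) ^ (-(1 / 3 : ℝ))
             let P := localGibbsLaw σ (fun _ => a₀) (fun _ => u₀) (fun _ => θ₀) N (Φ N)
             let act := fun (i : Fin (N + 1)) (t : ℝ) (z : Config (N + 1) (Fin 3) T3) =>
               σ / τ * (Φ N).collisionSum (Set.Ioo 0 t)
                 (fun c => if c.fst = i then ‖c.postVel.1 - c.preVel.1‖ else 0) z
             let cnt := fun (i : Fin (N + 1)) (t : ℝ) (z : Config (N + 1) (Fin 3) T3) =>
               (Φ N).collisionSum (Set.Ioo 0 t) (fun c => if c.fst = i then (1 : ℝ) else 0) z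
             let ω := fun (i : Fin (N + 1)) (t : ℝ) (z : Config (N + 1) (Fin 3) T3) =>
               if act i t z ≤ V ∧ cnt i t z ≤ V * τ then (1 : ℝ) else 0
             let Iw := fun (z : Config (N + 1) (Fin 3) T3) =>
               (Φ N).collisionSum (Set.Ioc 0 w)
                 (fun c => ω c.fst c.time z * ω c.snd c.time z * h c.fstPos c.preVel c.postVel) z
             ∫⁻ z, ENNReal.ofReal (Real.exp (β / (τ * σ ^ 2) * Iw z)) ∂P
               ≤ ENNReal.ofReal (Real.exp (ε * ((N : ℝ) + 1)))) := by
  sorry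

/-- **D₂ — PAIR-CLAMPED PARTNER/RATE-INNOVATION PRESSURE WITH THE LOCAL ENSKOG COMPENSATOR, SYMMETRIC LINEAR CLASS**
(dynamical; the hardest). For every continuous SYMMETRIC pair test function `m x (v, v_*) = m x (v_*, v)` of LINEAR
growth `|m| ≤ C(1+‖v‖+‖v_*‖)` (model: half the flux-normalised angle-average of the PAIR corrector increment given the
incoming pair — linear pointwise by the radial log-modulus of the ℓ=1 profiles, wave-1 N2) and every locality parameter
`κ`: the PAIR-clamped collision sum `Σ_c ω_fst(t_c) ω_snd(t_c) m(x_fst; v_fst⁻, v_snd⁻)` MINUS its LOCAL ENSKOG COMPENSATOR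
over ON partners `∫₀ʷ Σ_i ω_i(r) rate_i(r) dr`,
`rate_i = Y(η_i^loc) · ε_N² · |B_δ|⁻¹ Σ_{j ≠ i, dist(x_i,x_j) < δ} ω_j(r) (∫((v_i−v_j)·n)₊ dn) m(x_i; v_i, v_j)` (partners from the EMPIRICAL
law of the ON particles in the ball of radius `δ = κ (N+1)^{-1/3}`, contact value `Y(η) = (Z(η') − 1)/((2π/3)η')`,
`η' = min(η, 8σ³)`, `Z = hsCompressibility`, at the local empirical reduced density of ALL particles CAPPED at eight times
the mean reduced density `σ³` — rev 5: uncapped, `Y(η^loc) → ∞` in jammed regions (free-volume EOS, `Y ≍ ε/g`), and ON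
"pocket" spheres that never collide inside a macroscopic jammed OFF cluster (gaps `xε`, cost `c₀ + 3log(1/x)` per member,
pockets `O(1)` each) accrue compensator `≍ 1/x` per pocket pair for the whole window: pressure/N > 0 for every `β ≠ 0`; with
the cap the mismatch of any ON sphere is bounded by its actual count `≤ Vτ` (coupled `≤ βVC/σ²`, `τ`-free) against the
`τ`-free profile cost, and `Y` is only ever evaluated inside the PROVED analytic low-density regime of `HsEosLowDensity`
for `σ < σ₀` small; profiles below the cap keep the exact `Y(η^loc)`, so the registrar's linear-gain objection to a constant
`Y` does not return) — has per-particle pressure `≤ ε` at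
coupling `β/(τσ²)`, uniformly in `N`, CLASS-UNIFORM `V₀, β₀` and the tail `∀ ε ∃ κ₀ ∀ κ ≥ κ₀ ∃ τ₀ ∀ τ ≥ τ₀ ∃ N₀ ∀ N ≥ N₀`.
Rev-4 note (wave-1 N1): with the log-linear class of rev 3 this statement is FALSE — an ON sphere of speed `s` that
avoids all collisions (void cost `πYσ²sτ`) still accrues its compensator `≍ πYCσ²s²τ log s`, pressure/N ≥ (πβCY/2)log N at
`s² = N`; with LINEAR `m` the same witness gives `2πβCY s²` vs `s²/(2θ₀)`: finite, class-uniform `β₀ < 1/(4πθ₀CY)`.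
Registrar's typing notes stand (locality at a vanishing scale and `Y(η^loc)` necessary; `κ₀(ε)`; `τ₀ ≳ σ⁴κ²`). Test
`m ≡ 1`: pair-clamped collision count vs integrated on-partner Enskog rate. Why it might fail: non-summable ring/recollision
correlations of the deterministic partner stream at fixed `σ³` over `τσ² → ∞` mean free times; an LD-cheap persistent pair
structure at contact not captured by `Y(η^loc)`.
[sources: BGSSCPAM2023 §§4–5; Spohn1991 §I.8 (8.41); PulvirentiSimonella arXiv:1504.03215; Ruelle1969 §3.4] -/
theorem stub_partnerInnovationPressure :
    ∃ σ₀ : ℝ, 0 < σ₀ ∧ ∀ (a₀ θ₀ : ℝ) (u₀ : V3), 0 < a₀ → 0 < θ₀ → ∀ σ : ℝ, 0 < σ → σ < σ₀ →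
      ∀ Φ : (N : ℕ) → HardSphereFlow (Torus.geometry (Fin 3)) (hsDiameter σ N) (N + 1),
      ∀ C : ℝ, 0 ≤ C →
        ∃ V₀ : ℝ, 0 < V₀ ∧ ∀ V : ℝ, V₀ ≤ V → ∃ β₀ : ℝ, 0 < β₀ ∧ ∀ β : ℝ, |β| ≤ β₀ →
        ∀ m : T3 → V3 × V3 → ℝ, Continuous (fun q : T3 × (V3 × V3) => m q.1 q.2) →
          (∀ x p, m x p = m x (p.2, p.1)) →
          (∀ x p, |m x p| ≤ C * (1 + ‖p.1‖ + ‖p.2‖)) →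
          ∀ ε : ℝ, 0 < ε → ∃ κ₀ : ℝ, 0 < κ₀ ∧ ∀ κ : ℝ, κ₀ ≤ κ →
            ∃ τ₀ : ℝ, 0 < τ₀ ∧ ∀ τ : ℝ, τ₀ ≤ τ → ∃ N₀ : ℕ, ∀ N : ℕ, N₀ ≤ N →
            (let w : ℝ := τ * ((N : ℝ) + 1) ^ (-(1 / 3 : ℝ))
             let P := localGibbsLaw σ (fun _ => a₀) (fun _ => u₀) (fun _ => θ₀) N (Φ N)
             let act := fun (i : Fin (N + 1)) (t : ℝ) (z : Config (N + 1) (Fin 3) T3) =>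
               σ / τ * (Φ N).collisionSum (Set.Ioo 0 t)
                 (fun c => if c.fst = i then ‖c.postVel.1 - c.preVel.1‖ else 0) z
             let cnt := fun (i : Fin (N + 1)) (t : ℝ) (z : Config (N + 1) (Fin 3) T3) =>
               (Φ N).collisionSum (Set.Ioo 0 t) (fun c => if c.fst = i then (1 : ℝ) else 0) z
             let ω := fun (i : Fin (N + 1)) (t : ℝ) (z : Config (N + 1) (Fin 3) T3) =>
               if act i t z ≤ V ∧ cnt i t z ≤ V * τ then (1 : ℝ) else 0
             let δ : ℝ := κ * ((N : ℝ) + 1) ^ (-(1 / 3 : ℝ))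
             let near := fun (i j : Fin (N + 1)) (r : ℝ) (z : Config (N + 1) (Fin 3) T3) =>
               if j ≠ i ∧ Torus.euclidDist ((Φ N).flow r z i).1 ((Φ N).flow r z j).1 < δ
                 then (1 : ℝ) else 0
             let ηloc := fun (i : Fin (N + 1)) (r : ℝ) (z : Config (N + 1) (Fin 3) T3) =>
               σ ^ 3 / (((N : ℝ) + 1) * (4 / 3 * Real.pi * δ ^ 3)) * ∑ j, near i j r z
             let Y := fun (η : ℝ) =>
               (hsCompressibility (min η (8 * σ ^ 3)) - 1) / (2 / 3 * Real.pi * min η (8 * σ ^ 3))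
             let rate := fun (i : Fin (N + 1)) (r : ℝ) (z : Config (N + 1) (Fin 3) T3) =>
               Y (ηloc i r z) * hsDiameter σ N ^ 2 / (4 / 3 * Real.pi * δ ^ 3) *
                 ∑ j, near i j r z * ω j r z *
                   ((∫ n, hardSphereKernel (((Φ N).flow r z i).2, ((Φ N).flow r z j).2) n
                       ∂sphereMeasure) *
                     m ((Φ N).flow r z i).1 (((Φ N).flow r z i).2, ((Φ N).flow r z j).2))
             let Pw := fun (z : Config (N + 1) (Fin 3) T3) =>
               (Φ N).collisionSum (Set.Ioc 0 w)
                   (fun c => ω c.fst c.time z * ω c.snd c.time z * m c.fstPos c.preVel) z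
                 - ∫ r in (0 : ℝ)..w, ∑ i, ω i r z * rate i r z
             ∫⁻ z, ENNReal.ofReal (Real.exp (β / (τ * σ ^ 2) * Pw z)) ∂P
               ≤ ENNReal.ofReal (Real.exp (ε * ((N : ℝ) + 1)))) := by
  sorry

/-- **D₃ — CLAMP PRICE UNDER THE INVARIANT LAW** (equilibrium large-deviation census; VERBATIM rev 1). The
particles switched off by the end of the window (window activity `> V` OR window collision count `> Vτ`),
weighted by `1 +` their window-averaged kinetic energy (the pathwise bound on their uncompensated contribution
`w⁻¹∫|G| ≤ C'(1 + avg‖v‖²)` to the target), have per-particle pressure `≤ ε` under `G_N` for every `V ≥ V₀`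
(`V₀` just above the equilibrium mean window activity `≍ σ³√θ₀` and mean count rate `≍ σ²√θ₀` per unit `τ`)
and `0 < β ≤ β₁ < 1/(4θ₀)`, once `τ ≥ τ₀(V, β, ε)` — order `∃ V₀ ∃ β₁ ∀ V ≥ V₀ ∀ β ≤ β₁ ∀ ε ∃ τ₀ ∀ τ ∃ N₀ ∀ N`
(smallness from `τ → ∞` at FIXED `V`: tagged-particle window LLN, route doc F2 — dynamical but soft; initially
fast spheres thermalise within `O(log s)` collisions, so no fixed Gaussian fraction is flagged at fixed `V`;
a collective switched-off cluster of `k` members costs `≥ k Δf(σ³)` against a gain `≤ kβ(1+3θ₀)`). Why it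
might fail: heavy tails of the tagged-particle collision count under the invariant hard-sphere law (long-lived
cages), or an LD-cheap macroscopic fraction of caged particles at low density.
[sources: OllaVaradhanYau1993 §2; Spohn1991 Part I §2.3; CercignaniIllnerPulvirenti1994 §7.1] -/
theorem stub_activityCensus :
    ∃ σ₀ : ℝ, 0 < σ₀ ∧ ∀ (a₀ θ₀ : ℝ) (u₀ : V3), 0 < a₀ → 0 < θ₀ → ∀ σ : ℝ, 0 < σ → σ < σ₀ →
      ∀ Φ : (N : ℕ) → HardSphereFlow (Torus.geometry (Fin 3)) (hsDiameter σ N) (N + 1),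
      ∃ V₀ : ℝ, 0 < V₀ ∧ ∃ β₁ : ℝ, 0 < β₁ ∧ ∀ V : ℝ, V₀ ≤ V → ∀ β : ℝ, 0 < β → β ≤ β₁ →
        ∀ ε : ℝ, 0 < ε → ∃ τ₀ : ℝ, 0 < τ₀ ∧ ∀ τ : ℝ, τ₀ ≤ τ →
          ∃ N₀ : ℕ, ∀ N : ℕ, N₀ ≤ N →
            (let w : ℝ := τ * ((N : ℝ) + 1) ^ (-(1 / 3 : ℝ))
             let P := localGibbsLaw σ (fun _ => a₀) (fun _ => u₀) (fun _ => θ₀) N (Φ N)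
             let actw := fun (i : Fin (N + 1)) (z : Config (N + 1) (Fin 3) T3) =>
               σ / τ * (Φ N).collisionSum (Set.Ioc 0 w)
                 (fun c => if c.fst = i then ‖c.postVel.1 - c.preVel.1‖ else 0) z
             let cntw := fun (i : Fin (N + 1)) (z : Config (N + 1) (Fin 3) T3) =>
               (Φ N).collisionSum (Set.Ioc 0 w) (fun c => if c.fst = i then (1 : ℝ) else 0) z
             let off := fun (i : Fin (N + 1)) (z : Config (N + 1) (Fin 3) T3) =>
               if actw i z ≤ V ∧ cntw i z ≤ V * τ then (0 : ℝ) else 1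
             ∫⁻ z, ENNReal.ofReal (Real.exp (β * ∑ i : Fin (N + 1),
                 off i z * (1 + w⁻¹ * ∫ r in (0 : ℝ)..w, ‖((Φ N).flow r z i).2‖ ^ 2))) ∂P
               ≤ ENNReal.ofReal (Real.exp (ε * ((N : ℝ) + 1)))) := by
  sorry

/-- **D₄ — RUN CENSUS, CONTAMINATION FORM** (equilibrium large-deviation census; rev 4, wave-1 rescue N3). With
`ret(c) = ω_fst(t_c)ω_snd(t_c)` the retained indicator of a record (predictable statuses), the non-retained remainder of the
corrector identity (★) is `Σ_{ret=0}(Δĝ_fst) = Σ_i Σ_{runs ρ of i}[ĝ(z_i(t_end(ρ)⁺)) − ĝ(z_i(t_start(ρ)⁻))] − (transport inside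
runs)`, a run being a maximal block of consecutive own records with `ret = 0` (velocity is constant between own records);
every run boundary value is `v_i(0)`, `v_i(w)` or a pre/post velocity of an adjacent RETAINED own record. Hence, with
`Ψ(r) = (1+r)(1+log(1+r))` and `nret_i = #{own records in (0,w] with ret = 0}`, the CONTAMINATION functional
`Cont = Σ_i min(1, nret_i)·[Ψ(‖v_i(0)‖) + Ψ(‖v_i(w)‖) + Σ_{own records c} ret(c)(Ψ(‖v⁻‖) + Ψ(‖v⁺‖))]`
dominates the run census pathwise, and `|Σ_{ret=0}Δĝ_fst| ≤ cC'·Cont + static transport` for a corrector `|ĝ| ≤ cC'Ψ`.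
CLAIM: per-particle pressure `≤ ε` at coupling `λ/(τσ²)` for SOME `λ = λ₀(V) > 0` chosen after `V`:
`∃ V₀ ∀ V ≥ V₀ ∃ λ₀ > 0 ∀ ε ∃ τ₀ ∀ τ ≥ τ₀ ∃ N₀ ∀ N` (monotone in `λ`; T uses `λ = βcC'/Y ≤ λ₀(V(C'))`, so `β₁(C')` stays
free of any Lipschitz constant or support radius). FINITE for all parameters pathwise: an on particle has `≤ Vτ+1` retained
own records, so `Cont ≤ (2Vτ+4)·Σ_iΨ(√(2E_tot))`, sub-linear in the chi-square total energy. Wave-1 witness table (all LD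
losers for `λ < λ₀(V) ≍ σ³/V ∧ c₀σ²/(VΨ₀) ∧ σ²I(V)/(ν̄(V+ν̄)Ψ₀)`): cradle chains (hops inside runs cost nothing; `2Ψ(s)`
per packet), status-defect factories (debris double row: threshold `λ* ≈ 6σ³/V`), fast on sphere with alternating partners
(`≤ 2Vτ+4` switches), off fast grazer in a tuned corridor (grazed partners charged their own thermal values), compressed /
exploding / hot clusters (`≤ 2Vτ+4` thermal charges per member, gap-independent), thermal off sphere in the dilute phase
(`∝ τ` charge vs `τI(V)` cost), naturally fast initial spheres (off only if `s ≳ Vτ/(2σ)`), ring cradles (no x-term exists).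
Smallness inputs (honest status = D₃'s, dynamical but soft): `ρ_off(τ) → 0` faster than `1/τ` at fixed `V` (tagged-particle
window LD), bounded coupled charge per off particle in the dilute phase, cluster free-energy bounds. Why it might fail: a
sub-`1/τ` decay of the off density (the sharper run census with look-back `prevRet` needs only `ρ_off → 0`; kept as the
fallback typing), or a cheaper defect factory than the debris double row.
[sources: OllaVaradhanYau1993 §2; Spohn1991 §I.8; BuragoFerlegerKononenko1998 (finite collision counts of free clusters)] -/
theorem stub_runCensus :
    ∃ σ₀ : ℝ, 0 < σ₀ ∧ ∀ (a₀ θ₀ : ℝ) (u₀ : V3), 0 < a₀ → 0 < θ₀ → ∀ σ : ℝ, 0 < σ → σ < σ₀ →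
      ∀ Φ : (N : ℕ) → HardSphereFlow (Torus.geometry (Fin 3)) (hsDiameter σ N) (N + 1),
      ∃ V₀ : ℝ, 0 < V₀ ∧ ∀ V : ℝ, V₀ ≤ V → ∃ lam : ℝ, 0 < lam ∧
        ∀ ε : ℝ, 0 < ε → ∃ τ₀ : ℝ, 0 < τ₀ ∧ ∀ τ : ℝ, τ₀ ≤ τ →
          ∃ N₀ : ℕ, ∀ N : ℕ, N₀ ≤ N →
            (let w : ℝ := τ * ((N : ℝ) + 1) ^ (-(1 / 3 : ℝ))
             let P := localGibbsLaw σ (fun _ => a₀) (fun _ => u₀) (fun _ => θ₀) N (Φ N)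
             let act := fun (i : Fin (N + 1)) (t : ℝ) (z : Config (N + 1) (Fin 3) T3) =>
               σ / τ * (Φ N).collisionSum (Set.Ioo 0 t)
                 (fun c => if c.fst = i then ‖c.postVel.1 - c.preVel.1‖ else 0) z
             let cnt := fun (i : Fin (N + 1)) (t : ℝ) (z : Config (N + 1) (Fin 3) T3) =>
               (Φ N).collisionSum (Set.Ioo 0 t) (fun c => if c.fst = i then (1 : ℝ) else 0) z
             let ω := fun (i : Fin (N + 1)) (t : ℝ) (z : Config (N + 1) (Fin 3) T3) =>
               if act i t z ≤ V ∧ cnt i t z ≤ V * τ then (1 : ℝ) else 0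
             let ret := fun (c : HardSphereCollisionRecord (Fin 3) T3 (N + 1))
                 (z : Config (N + 1) (Fin 3) T3) => ω c.fst c.time z * ω c.snd c.time z
             let Ψ := fun (r : ℝ) => (1 + r) * (1 + Real.log (1 + r))
             let nret := fun (i : Fin (N + 1)) (z : Config (N + 1) (Fin 3) T3) =>
               (Φ N).collisionSum (Set.Ioc 0 w) (fun c => if c.fst = i then 1 - ret c z else 0) z
             let retCharge := fun (i : Fin (N + 1)) (z : Config (N + 1) (Fin 3) T3) =>
               (Φ N).collisionSum (Set.Ioc 0 w)
                 (fun c => if c.fst = i then ret c z * (Ψ ‖c.preVel.1‖ + Ψ ‖c.postVel.1‖) else 0) z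
             let Cont := fun (z : Config (N + 1) (Fin 3) T3) =>
               ∑ i : Fin (N + 1), min 1 (nret i z) *
                 (Ψ ‖(z i).2‖ + Ψ ‖((Φ N).flow w z i).2‖ + retCharge i z)
             ∫⁻ z, ENNReal.ofReal (Real.exp (lam / (τ * σ ^ 2) * Cont z)) ∂P
               ≤ ENNReal.ofReal (Real.exp (ε * ((N : ℝ) + 1)))) := by
  sorry

/-- **T — THE CORRECTOR TRANSFER** `D₁ → D₂ → D₃ → D₄ → W_Lip` (kinetic theory + statics; L-sized; `W_Lip` = the landed
normal form restricted to `(x,v)`-Lipschitz observables with the tilt range free of the Lipschitz constant; L lifts it to `W`). Intended proof: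
(1) CORRECTOR REGULARITY on `𝒢(C')`: `−G(x,·) = L ĝ(x,·)`, `L` the linearised hard-sphere operator at
`M_{1,u₀,θ₀}` (solvable iff the three orthogonality clauses — Disproof (a.1)–(a.3) used HERE), SOME pre-image
`ĝ` (linear in `G(x,·)`), continuous, with the LOG-LINEAR bound `|ĝ(x,v)| ≤ c·C'(1+‖v‖)(1+log(1+‖v‖))`,
constants through `C'` ONLY (uniform in the support radius), and on the Lipschitz class the GRADIENT bounds
`|∇_vĝ(x,v)| ≤ c(C'+L')(1+log(1+‖v‖))`, `|ĝ(x,v)−ĝ(x',v)| ≤ cL'(1+‖v‖)(1+log(1+‖v‖))·dist(x,x')` (Grad's gain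
kernel has an integrable `|v−v'|^{-2}` gradient singularity in `ℝ³`, `ν` is smooth, `ĝ = ν⁻¹(Kĝ + G)`; these constants
enter ONLY the coupling `λ` of D₄ and the mollification-free transport term — this is the sharp class: the `ℓ=1`
sector is resonant at linear growth, `L(v_j log|v|) = −(π/4)|v|v_j + O(|v|)`, so `|v|log|v|` occurs and nothing
worse is expected; tree: `exists_gap_and_inverse_linearizedHardSpherePMap`, `LinearizedBoltzmann*Inverse` give
`L²`, continuity and `(1+|v|²)²`; the log-linear bound is OPEN analysis, the honest analytic residue of T);
(2) the EXACT pathwise corrector identity (★) along good orbits for the UNCLAMPED sum `S(t) = Σ_i ĝ(z_i(t))` (no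
boundary terms): between collisions `dS/dt = Σ_i v_i·∇ₓĝ(z_i)` (transport, all particles, coupling
`β(N+1)^{-1/3}/(Yσ²) → 0`, static); at a collision of `i, j` the jump is the PAIR increment `Δĝ_i + Δĝ_j`; if both
are on before (predictable statuses) the two records are RETAINED by the pair-clamped streams and carry
`Δĝ_i + Δĝ_j = (h_ĝ)_i + (h_ĝ)_j + (m_ĝ)_i + (m_ĝ)_j` with `h_ĝ(x,p,p') = ĝ(x,p'.1) − ĝ(x,p.1) − m_ĝ(x,p)`,
`m_ĝ(x,p) = flux(p)⁻¹∫((p.1−p.2)·n)₊(ĝ(x,(collide n p).1) − ĝ(x,p.1))dn`; since both records of a retained pair carry the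
same weight, only the fst/snd-SYMMETRISATIONS enter: T feeds `h := ½(PI_ĝ − μ_ĝ)`, `m := ½μ_ĝ` with
`PI_ĝ(x;p,p') = ĝ(x,p'.1)+ĝ(x,p'.2)−ĝ(x,p.1)−ĝ(x,p.2)`, `μ_ĝ = E_ω[PI_ĝ | p]` — kinematically centred resp. symmetric, and
LINEAR pointwise (`|PI_ĝ(x;p,collide n p)| ≤ cC'(1+‖p.1‖+‖p.2‖)` by the radial log-modulus of the ℓ=1 profiles, T2; using
`x_fst` for both particles costs a static `O(βL'V N^{-1/3})`); the records with `ret = 0` telescope per particle along runs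
and are priced by D₄ at `λ = βcC'/Y` plus the static transport inside runs. The D₂
compensator over ON partners Hoeffding-decomposes as `m_ĝ·flux = L⁽¹⁾ĝ(x_i,v_i) + L⁽²⁾ĝ(x_i,v_j) + k₂` with
`L⁽¹⁾ĝ + L⁽²⁾ĝ = Lĝ = −G` pointwise (the `x_i/x_j` swap is the `δ`-continuity error), giving the target
`∫₀ʷ Σ_i ω_i ρ^{ω}_i G(z_i)` up to the doubly-centred U-statistic, the `Y(η^loc)`-linearisation and the
on-density deficit; (3) STATIC PRICING by landed devices of the `Sketch` line (`stub_oneSiteGauss` p114839,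
`stub_staticReduction` p115071, `stub_holderSplit` p118138, `stub_dualFamily` p116778, Jensen in time +
`measurePreserving_flow_localGibbsLaw_const`, `windowMoment_eventually_of_exists` p134349): `S(0)`, on-part of
`S(w)` (one-site Gaussian for the sub-Gaussian `|v|log|v|` class at coupling `β/(Yτσ²)`: pressure `O(β²/(τ²σ⁴))`),
transport (`β(N+1)^{-1/3}/σ²`, all particles), U-statistic (`O(β²/κ³)`), smearing defects, switched-off particles in
the target (D₃ at coupling `βcC'`), the non-retained runs (D₄ at `λ = βcC'/Y ≤ λ₀(V)`), NO v-mollification (never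
needed), x-Lipschitz from the class (transport; T3 follows from T1 by linearity of `L⁻¹`); (4) Hölder assembly with
`β`-proportional weights; boost/scaling to `u₀ = 0, θ₀ = 1`. Bookkeeping: `V := max(V₀^{D₁}(cC'), V₀^{D₂}(cC'), V₀^{D₃},
V₀^{D₄})` and `β₁ := min(β₀^{D₁}(V), β₀^{D₂}(V), β₁^{D₃}/(cC'), λ₀^{D₄}(V)Y/(cC'), static)/10` are fixed from `C'` alone;
given `G` (hence `L'`, `R`), `β`, `ε`: `κ ≥ κ₀(ε)`, then `τ ≥ max τ₀ⁱ`, then `N₀` (where `L'`, `R` enter). OPEN inside T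
(the honest analytic residue, sharpened by wave 1): (T1) the `R`-uniform log-linear bound `|ĝ(x,v)| ≤ cC'Ψ(v)` for some
pre-image; (T2) the radial log-modulus of the ℓ=1 profiles `|Φ(r) − Φ(S)| ≤ (4C'/π)log(S/r) + O(C')` (both follow from the
radial ODE `Φ(s) = 4∫^s γ dt/t + γ + const`, `γ = G₁/(πs²)`, of the Lorentz limit — to be made rigorous with the tree's
`LinearizedBoltzmann*` machinery). Why it might fail: (T1)/(T2); a remainder of (★) not dominated by D₃/D₄ as typed. [sources: CercignaniIllnerPulvirenti1994 §7.1; KipnisLandim1999 App. 1 §6–7;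
GST2013 §4.1; OllaVaradhanYau1993 §2] -/
theorem stub_correctorTransfer :
    (∃ σ₀ : ℝ, 0 < σ₀ ∧ ∀ (a₀ θ₀ : ℝ) (u₀ : V3), 0 < a₀ → 0 < θ₀ → ∀ σ : ℝ, 0 < σ → σ < σ₀ →
      ∀ Φ : (N : ℕ) → HardSphereFlow (Torus.geometry (Fin 3)) (hsDiameter σ N) (N + 1),
      ∀ C : ℝ, 0 ≤ C →
        ∃ V₀ : ℝ, 0 < V₀ ∧ ∀ V : ℝ, V₀ ≤ V → ∃ β₀ : ℝ, 0 < β₀ ∧ ∀ β : ℝ, |β| ≤ β₀ →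
        ∀ h : T3 → V3 × V3 → V3 × V3 → ℝ,
          Continuous (fun q : T3 × (V3 × V3) × (V3 × V3) => h q.1 q.2.1 q.2.2) →
          (∀ x p p', |h x p p'| ≤
              C * (1 + ‖p.1‖ + ‖p.2‖) * (1 + Real.log (1 + ‖p.1‖ + ‖p.2‖))) →
          (∀ (x : T3) (p : V3 × V3),
            ∫ n, hardSphereKernel p n * h x p (collide n p) ∂sphereMeasure = 0) →
          ∀ ε : ℝ, 0 < ε → ∃ τ₀ : ℝ, 0 < τ₀ ∧ ∀ τ : ℝ, τ₀ ≤ τ → ∃ N₀ : ℕ, ∀ N : ℕ, N₀ ≤ N →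
            (let w : ℝ := τ * ((N : ℝ) + 1) ^ (-(1 / 3 : ℝ))
             let P := localGibbsLaw σ (fun _ => a₀) (fun _ => u₀) (fun _ => θ₀) N (Φ N)
             let act := fun (i : Fin (N + 1)) (t : ℝ) (z : Config (N + 1) (Fin 3) T3) =>
               σ / τ * (Φ N).collisionSum (Set.Ioo 0 t)
                 (fun c => if c.fst = i then ‖c.postVel.1 - c.preVel.1‖ else 0) z
             let cnt := fun (i : Fin (N + 1)) (t : ℝ) (z : Config (N + 1) (Fin 3) T3) =>
               (Φ N).collisionSum (Set.Ioo 0 t) (fun c => if c.fst = i then (1 : ℝ) else 0) z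
             let ω := fun (i : Fin (N + 1)) (t : ℝ) (z : Config (N + 1) (Fin 3) T3) =>
               if act i t z ≤ V ∧ cnt i t z ≤ V * τ then (1 : ℝ) else 0
             let Iw := fun (z : Config (N + 1) (Fin 3) T3) =>
               (Φ N).collisionSum (Set.Ioc 0 w)
                 (fun c => ω c.fst c.time z * ω c.snd c.time z * h c.fstPos c.preVel c.postVel) z
             ∫⁻ z, ENNReal.ofReal (Real.exp (β / (τ * σ ^ 2) * Iw z)) ∂P
               ≤ ENNReal.ofReal (Real.exp (ε * ((N : ℝ) + 1))))) →
    (∃ σ₀ : ℝ, 0 < σ₀ ∧ ∀ (a₀ θ₀ : ℝ) (u₀ : V3), 0 < a₀ → 0 < θ₀ → ∀ σ : ℝ, 0 < σ → σ < σ₀ →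
      ∀ Φ : (N : ℕ) → HardSphereFlow (Torus.geometry (Fin 3)) (hsDiameter σ N) (N + 1),
      ∀ C : ℝ, 0 ≤ C →
        ∃ V₀ : ℝ, 0 < V₀ ∧ ∀ V : ℝ, V₀ ≤ V → ∃ β₀ : ℝ, 0 < β₀ ∧ ∀ β : ℝ, |β| ≤ β₀ →
        ∀ m : T3 → V3 × V3 → ℝ, Continuous (fun q : T3 × (V3 × V3) => m q.1 q.2) →
          (∀ x p, m x p = m x (p.2, p.1)) →
          (∀ x p, |m x p| ≤ C * (1 + ‖p.1‖ + ‖p.2‖)) →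
          ∀ ε : ℝ, 0 < ε → ∃ κ₀ : ℝ, 0 < κ₀ ∧ ∀ κ : ℝ, κ₀ ≤ κ →
            ∃ τ₀ : ℝ, 0 < τ₀ ∧ ∀ τ : ℝ, τ₀ ≤ τ → ∃ N₀ : ℕ, ∀ N : ℕ, N₀ ≤ N →
            (let w : ℝ := τ * ((N : ℝ) + 1) ^ (-(1 / 3 : ℝ))
             let P := localGibbsLaw σ (fun _ => a₀) (fun _ => u₀) (fun _ => θ₀) N (Φ N)
             let act := fun (i : Fin (N + 1)) (t : ℝ) (z : Config (N + 1) (Fin 3) T3) =>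
               σ / τ * (Φ N).collisionSum (Set.Ioo 0 t)
                 (fun c => if c.fst = i then ‖c.postVel.1 - c.preVel.1‖ else 0) z
             let cnt := fun (i : Fin (N + 1)) (t : ℝ) (z : Config (N + 1) (Fin 3) T3) =>
               (Φ N).collisionSum (Set.Ioo 0 t) (fun c => if c.fst = i then (1 : ℝ) else 0) z
             let ω := fun (i : Fin (N + 1)) (t : ℝ) (z : Config (N + 1) (Fin 3) T3) =>
               if act i t z ≤ V ∧ cnt i t z ≤ V * τ then (1 : ℝ) else 0
             let δ : ℝ := κ * ((N : ℝ) + 1) ^ (-(1 / 3 : ℝ))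
             let near := fun (i j : Fin (N + 1)) (r : ℝ) (z : Config (N + 1) (Fin 3) T3) =>
               if j ≠ i ∧ Torus.euclidDist ((Φ N).flow r z i).1 ((Φ N).flow r z j).1 < δ
                 then (1 : ℝ) else 0
             let ηloc := fun (i : Fin (N + 1)) (r : ℝ) (z : Config (N + 1) (Fin 3) T3) =>
               σ ^ 3 / (((N : ℝ) + 1) * (4 / 3 * Real.pi * δ ^ 3)) * ∑ j, near i j r z
             let Y := fun (η : ℝ) =>
               (hsCompressibility (min η (8 * σ ^ 3)) - 1) / (2 / 3 * Real.pi * min η (8 * σ ^ 3))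
             let rate := fun (i : Fin (N + 1)) (r : ℝ) (z : Config (N + 1) (Fin 3) T3) =>
               Y (ηloc i r z) * hsDiameter σ N ^ 2 / (4 / 3 * Real.pi * δ ^ 3) *
                 ∑ j, near i j r z * ω j r z *
                   ((∫ n, hardSphereKernel (((Φ N).flow r z i).2, ((Φ N).flow r z j).2) n
                       ∂sphereMeasure) *
                     m ((Φ N).flow r z i).1 (((Φ N).flow r z i).2, ((Φ N).flow r z j).2))
             let Pw := fun (z : Config (N + 1) (Fin 3) T3) =>
               (Φ N).collisionSum (Set.Ioc 0 w)
                   (fun c => ω c.fst c.time z * ω c.snd c.time z * m c.fstPos c.preVel) z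
                 - ∫ r in (0 : ℝ)..w, ∑ i, ω i r z * rate i r z
             ∫⁻ z, ENNReal.ofReal (Real.exp (β / (τ * σ ^ 2) * Pw z)) ∂P
               ≤ ENNReal.ofReal (Real.exp (ε * ((N : ℝ) + 1))))) →
    (∃ σ₀ : ℝ, 0 < σ₀ ∧ ∀ (a₀ θ₀ : ℝ) (u₀ : V3), 0 < a₀ → 0 < θ₀ → ∀ σ : ℝ, 0 < σ → σ < σ₀ →
      ∀ Φ : (N : ℕ) → HardSphereFlow (Torus.geometry (Fin 3)) (hsDiameter σ N) (N + 1),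
      ∃ V₀ : ℝ, 0 < V₀ ∧ ∃ β₁ : ℝ, 0 < β₁ ∧ ∀ V : ℝ, V₀ ≤ V → ∀ β : ℝ, 0 < β → β ≤ β₁ →
        ∀ ε : ℝ, 0 < ε → ∃ τ₀ : ℝ, 0 < τ₀ ∧ ∀ τ : ℝ, τ₀ ≤ τ →
          ∃ N₀ : ℕ, ∀ N : ℕ, N₀ ≤ N →
            (let w : ℝ := τ * ((N : ℝ) + 1) ^ (-(1 / 3 : ℝ))
             let P := localGibbsLaw σ (fun _ => a₀) (fun _ => u₀) (fun _ => θ₀) N (Φ N)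
             let actw := fun (i : Fin (N + 1)) (z : Config (N + 1) (Fin 3) T3) =>
               σ / τ * (Φ N).collisionSum (Set.Ioc 0 w)
                 (fun c => if c.fst = i then ‖c.postVel.1 - c.preVel.1‖ else 0) z
             let cntw := fun (i : Fin (N + 1)) (z : Config (N + 1) (Fin 3) T3) =>
               (Φ N).collisionSum (Set.Ioc 0 w) (fun c => if c.fst = i then (1 : ℝ) else 0) z
             let off := fun (i : Fin (N + 1)) (z : Config (N + 1) (Fin 3) T3) =>
               if actw i z ≤ V ∧ cntw i z ≤ V * τ then (0 : ℝ) else 1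
             ∫⁻ z, ENNReal.ofReal (Real.exp (β * ∑ i : Fin (N + 1),
                 off i z * (1 + w⁻¹ * ∫ r in (0 : ℝ)..w, ‖((Φ N).flow r z i).2‖ ^ 2))) ∂P
               ≤ ENNReal.ofReal (Real.exp (ε * ((N : ℝ) + 1))))) →
    (∃ σ₀ : ℝ, 0 < σ₀ ∧ ∀ (a₀ θ₀ : ℝ) (u₀ : V3), 0 < a₀ → 0 < θ₀ → ∀ σ : ℝ, 0 < σ → σ < σ₀ →
      ∀ Φ : (N : ℕ) → HardSphereFlow (Torus.geometry (Fin 3)) (hsDiameter σ N) (N + 1),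
      ∃ V₀ : ℝ, 0 < V₀ ∧ ∀ V : ℝ, V₀ ≤ V → ∃ lam : ℝ, 0 < lam ∧
        ∀ ε : ℝ, 0 < ε → ∃ τ₀ : ℝ, 0 < τ₀ ∧ ∀ τ : ℝ, τ₀ ≤ τ →
          ∃ N₀ : ℕ, ∀ N : ℕ, N₀ ≤ N →
            (let w : ℝ := τ * ((N : ℝ) + 1) ^ (-(1 / 3 : ℝ))
             let P := localGibbsLaw σ (fun _ => a₀) (fun _ => u₀) (fun _ => θ₀) N (Φ N)
             let act := fun (i : Fin (N + 1)) (t : ℝ) (z : Config (N + 1) (Fin 3) T3) =>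
               σ / τ * (Φ N).collisionSum (Set.Ioo 0 t)
                 (fun c => if c.fst = i then ‖c.postVel.1 - c.preVel.1‖ else 0) z
             let cnt := fun (i : Fin (N + 1)) (t : ℝ) (z : Config (N + 1) (Fin 3) T3) =>
               (Φ N).collisionSum (Set.Ioo 0 t) (fun c => if c.fst = i then (1 : ℝ) else 0) z
             let ω := fun (i : Fin (N + 1)) (t : ℝ) (z : Config (N + 1) (Fin 3) T3) =>
               if act i t z ≤ V ∧ cnt i t z ≤ V * τ then (1 : ℝ) else 0
             let ret := fun (c : HardSphereCollisionRecord (Fin 3) T3 (N + 1))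
                 (z : Config (N + 1) (Fin 3) T3) => ω c.fst c.time z * ω c.snd c.time z
             let Ψ := fun (r : ℝ) => (1 + r) * (1 + Real.log (1 + r))
             let nret := fun (i : Fin (N + 1)) (z : Config (N + 1) (Fin 3) T3) =>
               (Φ N).collisionSum (Set.Ioc 0 w) (fun c => if c.fst = i then 1 - ret c z else 0) z
             let retCharge := fun (i : Fin (N + 1)) (z : Config (N + 1) (Fin 3) T3) =>
               (Φ N).collisionSum (Set.Ioc 0 w)
                 (fun c => if c.fst = i then ret c z * (Ψ ‖c.preVel.1‖ + Ψ ‖c.postVel.1‖) else 0) z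
             let Cont := fun (z : Config (N + 1) (Fin 3) T3) =>
               ∑ i : Fin (N + 1), min 1 (nret i z) *
                 (Ψ ‖(z i).2‖ + Ψ ‖((Φ N).flow w z i).2‖ + retCharge i z)
             ∫⁻ z, ENNReal.ofReal (Real.exp (lam / (τ * σ ^ 2) * Cont z)) ∂P
               ≤ ENNReal.ofReal (Real.exp (ε * ((N : ℝ) + 1))))) →
    (∃ σ₀ : ℝ, 0 < σ₀ ∧ ∀ (a₀ θ₀ : ℝ) (u₀ : V3), 0 < a₀ → 0 < θ₀ → ∀ σ : ℝ, 0 < σ → σ < σ₀ →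
      ∀ Φ : (N : ℕ) → HardSphereFlow (Torus.geometry (Fin 3)) (hsDiameter σ N) (N + 1),
      ∀ C' : ℝ, 0 ≤ C' → ∃ β₁ : ℝ, 0 < β₁ ∧
      ∀ G : T3 × V3 → ℝ, Continuous G → (∀ y, |G y| ≤ C' * (1 + ‖y.2‖ ^ 2)) →
      (∃ R : ℝ, ∀ y : T3 × V3, R ≤ ‖y.2‖ → G y = 0) →
      (∃ L' : ℝ, (∀ x v v', |G (x, v) - G (x, v')| ≤ L' * ‖v - v'‖ * (1 + ‖v‖ + ‖v'‖)) ∧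
        (∀ x x' v, |G (x, v) - G (x', v)| ≤ L' * (1 + ‖v‖ ^ 2) * dist x x')) →
      (∀ x, ∫ v, G (x, v) * localMaxwellian 1 θ₀ u₀ v = 0) →
      (∀ x (j : Fin 3), ∫ v, G (x, v) * v j * localMaxwellian 1 θ₀ u₀ v = 0) →
      (∀ x, ∫ v, G (x, v) * ‖v‖ ^ 2 * localMaxwellian 1 θ₀ u₀ v = 0) →
      ∀ β : ℝ, |β| ≤ β₁ → ∀ ε : ℝ, 0 < ε → ∃ τ : ℝ, 0 < τ ∧ ∃ N₀ : ℕ, ∀ N : ℕ, N₀ ≤ N →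
        ∫⁻ z, ENNReal.ofReal (Real.exp (β * ∑ i : Fin (N + 1),
            (τ * ((N : ℝ) + 1) ^ (-(1 / 3 : ℝ)))⁻¹ *
              ∫ r in (0 : ℝ)..(τ * ((N : ℝ) + 1) ^ (-(1 / 3 : ℝ))), G (((Φ N).flow r z) i)))
          ∂(localGibbsLaw σ (fun _ => a₀) (fun _ => u₀) (fun _ => θ₀) N (Φ N)) ≤
          ENNReal.ofReal (Real.exp (ε * ((N : ℝ) + 1)))) := by
  sorry

/-- **L — THE LIPSCHITZ REDUCTION** `W_Lip → W` (STATIC, provable now from landed devices). `W_Lip` is the landed normal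
form `W` (bounded class `𝒢(C')`: continuous, `|G| ≤ C'(1+|v|²)`, compact `v`-support, the three orthogonality clauses,
class-uniform tilt `β₁(C')`) restricted to observables that are moreover LIPSCHITZ in `v` and in `x` with SOME constant
`L'` (`|G(x,v)−G(x,v')| ≤ L'‖v−v'‖(1+‖v‖+‖v'‖)`, `|G(x,v)−G(x',v)| ≤ L'(1+‖v‖²)·dist(x,x')` (instance metric of `𝕋³`)) — crucially `β₁`
is chosen BEFORE `G`, hence does not depend on `L'`. Proof idea: given `C'`, take `β₁ := β₁^{Lip}(C'+1)/2` (and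
`≤ μ₀/2`, the static tilt of `stub_staticReduction`/`stub_oneSiteGauss` at growth constant `1`); given continuous
`G ∈ 𝒢(C')` with support radius `R`, `β`, `ε`: mollify `G` on `𝕋³ × ℝ³` (convolution with a smooth compactly supported
bump; `𝕋³ × B_R` is compact so `G` is uniformly continuous) to get `G_δ` Lipschitz with ‖(G − G_δ)/(1+|v|²)‖_∞ ≤ η(δ) → 0`,
support radius `≤ R+1`, and restore the three orthogonality clauses EXACTLY by subtracting the projection onto the
bounded compactly supported dual family of `stub_dualFamily` (p116778) — coefficients are `x`-Lipschitz and `O(η)`;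
then `G = G_δ' + (G − G_δ')` with `G_δ' ∈ 𝒢_Lip(C'+1)` and a remainder of weighted size `O(η)`; Hölder with weights
`(1−ϑ, ϑ)` (`stub_holderSplit`, p118138): the first factor is `W_Lip` at tilt `β/(1−ϑ) ≤ 2|β| ≤ β₁^{Lip}(C'+1)`, the
second is static (`stub_staticReduction`, p115071: pressure `≤ K(βη/ϑ)²(N+1)`); choose `ϑ = 1/2`, then `η` so small that
`K(2βη)²·… ≤ ε/2`. (Same architecture as the landed `EquilibriumFastWindowLD_of_boundedWindowLD`.) Why it might fail:
only Lean plumbing (mollification on `𝕋³ × ℝ³` with control of the weighted sup norm and of compact support; the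
dual-family correction). [sources: DemboZeitouni2010 §4.3 (exponential approximation); the landed FastWindowRG files] -/
theorem stub_lipschitzReduction :
    (∃ σ₀ : ℝ, 0 < σ₀ ∧ ∀ (a₀ θ₀ : ℝ) (u₀ : V3), 0 < a₀ → 0 < θ₀ → ∀ σ : ℝ, 0 < σ → σ < σ₀ →
      ∀ Φ : (N : ℕ) → HardSphereFlow (Torus.geometry (Fin 3)) (hsDiameter σ N) (N + 1),
      ∀ C' : ℝ, 0 ≤ C' → ∃ β₁ : ℝ, 0 < β₁ ∧
      ∀ G : T3 × V3 → ℝ, Continuous G → (∀ y, |G y| ≤ C' * (1 + ‖y.2‖ ^ 2)) →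
      (∃ R : ℝ, ∀ y : T3 × V3, R ≤ ‖y.2‖ → G y = 0) →
      (∃ L' : ℝ, (∀ x v v', |G (x, v) - G (x, v')| ≤ L' * ‖v - v'‖ * (1 + ‖v‖ + ‖v'‖)) ∧
        (∀ x x' v, |G (x, v) - G (x', v)| ≤ L' * (1 + ‖v‖ ^ 2) * dist x x')) →
      (∀ x, ∫ v, G (x, v) * localMaxwellian 1 θ₀ u₀ v = 0) →
      (∀ x (j : Fin 3), ∫ v, G (x, v) * v j * localMaxwellian 1 θ₀ u₀ v = 0) →
      (∀ x, ∫ v, G (x, v) * ‖v‖ ^ 2 * localMaxwellian 1 θ₀ u₀ v = 0) →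
      ∀ β : ℝ, |β| ≤ β₁ → ∀ ε : ℝ, 0 < ε → ∃ τ : ℝ, 0 < τ ∧ ∃ N₀ : ℕ, ∀ N : ℕ, N₀ ≤ N →
        ∫⁻ z, ENNReal.ofReal (Real.exp (β * ∑ i : Fin (N + 1),
            (τ * ((N : ℝ) + 1) ^ (-(1 / 3 : ℝ)))⁻¹ *
              ∫ r in (0 : ℝ)..(τ * ((N : ℝ) + 1) ^ (-(1 / 3 : ℝ))), G (((Φ N).flow r z) i)))
          ∂(localGibbsLaw σ (fun _ => a₀) (fun _ => u₀) (fun _ => θ₀) N (Φ N)) ≤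
          ENNReal.ofReal (Real.exp (ε * ((N : ℝ) + 1)))) →
    (∃ σ₀ : ℝ, 0 < σ₀ ∧ ∀ (a₀ θ₀ : ℝ) (u₀ : V3), 0 < a₀ → 0 < θ₀ → ∀ σ : ℝ, 0 < σ → σ < σ₀ →
      ∀ Φ : (N : ℕ) → HardSphereFlow (Torus.geometry (Fin 3)) (hsDiameter σ N) (N + 1),
      ∀ C' : ℝ, 0 ≤ C' → ∃ β₁ : ℝ, 0 < β₁ ∧
      ∀ G : T3 × V3 → ℝ, Continuous G → (∀ y, |G y| ≤ C' * (1 + ‖y.2‖ ^ 2)) →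
      (∃ R : ℝ, ∀ y : T3 × V3, R ≤ ‖y.2‖ → G y = 0) →
      (∀ x, ∫ v, G (x, v) * localMaxwellian 1 θ₀ u₀ v = 0) →
      (∀ x (j : Fin 3), ∫ v, G (x, v) * v j * localMaxwellian 1 θ₀ u₀ v = 0) →
      (∀ x, ∫ v, G (x, v) * ‖v‖ ^ 2 * localMaxwellian 1 θ₀ u₀ v = 0) →
      ∀ β : ℝ, |β| ≤ β₁ → ∀ ε : ℝ, 0 < ε → ∃ τ : ℝ, 0 < τ ∧ ∃ N₀ : ℕ, ∀ N : ℕ, N₀ ≤ N →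
        ∫⁻ z, ENNReal.ofReal (Real.exp (β * ∑ i : Fin (N + 1),
            (τ * ((N : ℝ) + 1) ^ (-(1 / 3 : ℝ)))⁻¹ *
              ∫ r in (0 : ℝ)..(τ * ((N : ℝ) + 1) ^ (-(1 / 3 : ℝ))), G (((Φ N).flow r z) i)))
          ∂(localGibbsLaw σ (fun _ => a₀) (fun _ => u₀) (fun _ => θ₀) N (Φ N)) ≤
          ENNReal.ofReal (Real.exp (ε * ((N : ℝ) + 1)))) :=
  Summit.AtomisticToContinuum.HydrodynamicLimit.Theorems.ClampedCorrectorBirth.stub_lipschitzReduction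

/-! ## Composition: the six registered stubs imply the crux BY NAME -/

/-- **Composition of the line `birth` (rev 5)** (the registered skeleton's concluding theorem; no `sorry`
of its own, it inherits the stubs'): the six registered stubs, BY NAME, imply the crux
`TwoClocks.EquilibriumFastWindowLD` by name — the transfer stub delivers the Lipschitz-class normal form `W_Lip`
from D₁, D₂, D₃, D₄, the Lipschitz reduction upgrades it to the landed normal form `W`, and the LANDED reduction `FastWindowRG.EquilibriumFastWindowLD_of_boundedWindowLD`
(p125773) does the rest. -/
theorem EquilibriumFastWindowLD_of :
    Summit.AtomisticToContinuum.HydrodynamicLimit.Theses.TwoClocks.EquilibriumFastWindowLD :=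
  EquilibriumFastWindowLD_of_boundedWindowLD
    (stub_lipschitzReduction
      (stub_correctorTransfer stub_angleInnovationPressure stub_partnerInnovationPressure
        stub_activityCensus stub_runCensus))

/-- Hypothesis form of the same composition (sorry-free, axioms `propext`, `Classical.choice`,
`Quot.sound` only): the six statements (five stubs + the landed L), verbatim, imply the crux by name through the landed
reduction `FastWindowRG.EquilibriumFastWindowLD_of_boundedWindowLD` (p125773). -/
theorem EquilibriumFastWindowLD_of_statements :
    (∃ σ₀ : ℝ, 0 < σ₀ ∧ ∀ (a₀ θ₀ : ℝ) (u₀ : V3), 0 < a₀ → 0 < θ₀ → ∀ σ : ℝ, 0 < σ → σ < σ₀ →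
      ∀ Φ : (N : ℕ) → HardSphereFlow (Torus.geometry (Fin 3)) (hsDiameter σ N) (N + 1),
      ∀ C : ℝ, 0 ≤ C →
        ∃ V₀ : ℝ, 0 < V₀ ∧ ∀ V : ℝ, V₀ ≤ V → ∃ β₀ : ℝ, 0 < β₀ ∧ ∀ β : ℝ, |β| ≤ β₀ →
        ∀ h : T3 → V3 × V3 → V3 × V3 → ℝ,
          Continuous (fun q : T3 × (V3 × V3) × (V3 × V3) => h q.1 q.2.1 q.2.2) →
          (∀ x p p', |h x p p'| ≤
              C * (1 + ‖p.1‖ + ‖p.2‖) * (1 + Real.log (1 + ‖p.1‖ + ‖p.2‖))) →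
          (∀ (x : T3) (p : V3 × V3),
            ∫ n, hardSphereKernel p n * h x p (collide n p) ∂sphereMeasure = 0) →
          ∀ ε : ℝ, 0 < ε → ∃ τ₀ : ℝ, 0 < τ₀ ∧ ∀ τ : ℝ, τ₀ ≤ τ → ∃ N₀ : ℕ, ∀ N : ℕ, N₀ ≤ N →
            (let w : ℝ := τ * ((N : ℝ) + 1) ^ (-(1 / 3 : ℝ))
             let P := localGibbsLaw σ (fun _ => a₀) (fun _ => u₀) (fun _ => θ₀) N (Φ N)
             let act := fun (i : Fin (N + 1)) (t : ℝ) (z : Config (N + 1) (Fin 3) T3) =>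
               σ / τ * (Φ N).collisionSum (Set.Ioo 0 t)
                 (fun c => if c.fst = i then ‖c.postVel.1 - c.preVel.1‖ else 0) z
             let cnt := fun (i : Fin (N + 1)) (t : ℝ) (z : Config (N + 1) (Fin 3) T3) =>
               (Φ N).collisionSum (Set.Ioo 0 t) (fun c => if c.fst = i then (1 : ℝ) else 0) z
             let ω := fun (i : Fin (N + 1)) (t : ℝ) (z : Config (N + 1) (Fin 3) T3) =>
               if act i t z ≤ V ∧ cnt i t z ≤ V * τ then (1 : ℝ) else 0
             let Iw := fun (z : Config (N + 1) (Fin 3) T3) =>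
               (Φ N).collisionSum (Set.Ioc 0 w)
                 (fun c => ω c.fst c.time z * ω c.snd c.time z * h c.fstPos c.preVel c.postVel) z
             ∫⁻ z, ENNReal.ofReal (Real.exp (β / (τ * σ ^ 2) * Iw z)) ∂P
               ≤ ENNReal.ofReal (Real.exp (ε * ((N : ℝ) + 1))))) →
    (∃ σ₀ : ℝ, 0 < σ₀ ∧ ∀ (a₀ θ₀ : ℝ) (u₀ : V3), 0 < a₀ → 0 < θ₀ → ∀ σ : ℝ, 0 < σ → σ < σ₀ →
      ∀ Φ : (N : ℕ) → HardSphereFlow (Torus.geometry (Fin 3)) (hsDiameter σ N) (N + 1),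
      ∀ C : ℝ, 0 ≤ C →
        ∃ V₀ : ℝ, 0 < V₀ ∧ ∀ V : ℝ, V₀ ≤ V → ∃ β₀ : ℝ, 0 < β₀ ∧ ∀ β : ℝ, |β| ≤ β₀ →
        ∀ m : T3 → V3 × V3 → ℝ, Continuous (fun q : T3 × (V3 × V3) => m q.1 q.2) →
          (∀ x p, m x p = m x (p.2, p.1)) →
          (∀ x p, |m x p| ≤ C * (1 + ‖p.1‖ + ‖p.2‖)) →
          ∀ ε : ℝ, 0 < ε → ∃ κ₀ : ℝ, 0 < κ₀ ∧ ∀ κ : ℝ, κ₀ ≤ κ →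
            ∃ τ₀ : ℝ, 0 < τ₀ ∧ ∀ τ : ℝ, τ₀ ≤ τ → ∃ N₀ : ℕ, ∀ N : ℕ, N₀ ≤ N →
            (let w : ℝ := τ * ((N : ℝ) + 1) ^ (-(1 / 3 : ℝ))
             let P := localGibbsLaw σ (fun _ => a₀) (fun _ => u₀) (fun _ => θ₀) N (Φ N)
             let act := fun (i : Fin (N + 1)) (t : ℝ) (z : Config (N + 1) (Fin 3) T3) =>
               σ / τ * (Φ N).collisionSum (Set.Ioo 0 t)
                 (fun c => if c.fst = i then ‖c.postVel.1 - c.preVel.1‖ else 0) z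
             let cnt := fun (i : Fin (N + 1)) (t : ℝ) (z : Config (N + 1) (Fin 3) T3) =>
               (Φ N).collisionSum (Set.Ioo 0 t) (fun c => if c.fst = i then (1 : ℝ) else 0) z
             let ω := fun (i : Fin (N + 1)) (t : ℝ) (z : Config (N + 1) (Fin 3) T3) =>
               if act i t z ≤ V ∧ cnt i t z ≤ V * τ then (1 : ℝ) else 0
             let δ : ℝ := κ * ((N : ℝ) + 1) ^ (-(1 / 3 : ℝ))
             let near := fun (i j : Fin (N + 1)) (r : ℝ) (z : Config (N + 1) (Fin 3) T3) =>
               if j ≠ i ∧ Torus.euclidDist ((Φ N).flow r z i).1 ((Φ N).flow r z j).1 < δ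
                 then (1 : ℝ) else 0
             let ηloc := fun (i : Fin (N + 1)) (r : ℝ) (z : Config (N + 1) (Fin 3) T3) =>
               σ ^ 3 / (((N : ℝ) + 1) * (4 / 3 * Real.pi * δ ^ 3)) * ∑ j, near i j r z
             let Y := fun (η : ℝ) =>
               (hsCompressibility (min η (8 * σ ^ 3)) - 1) / (2 / 3 * Real.pi * min η (8 * σ ^ 3))
             let rate := fun (i : Fin (N + 1)) (r : ℝ) (z : Config (N + 1) (Fin 3) T3) =>
               Y (ηloc i r z) * hsDiameter σ N ^ 2 / (4 / 3 * Real.pi * δ ^ 3) *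
                 ∑ j, near i j r z * ω j r z *
                   ((∫ n, hardSphereKernel (((Φ N).flow r z i).2, ((Φ N).flow r z j).2) n
                       ∂sphereMeasure) *
                     m ((Φ N).flow r z i).1 (((Φ N).flow r z i).2, ((Φ N).flow r z j).2))
             let Pw := fun (z : Config (N + 1) (Fin 3) T3) =>
               (Φ N).collisionSum (Set.Ioc 0 w)
                   (fun c => ω c.fst c.time z * ω c.snd c.time z * m c.fstPos c.preVel) z
                 - ∫ r in (0 : ℝ)..w, ∑ i, ω i r z * rate i r z
             ∫⁻ z, ENNReal.ofReal (Real.exp (β / (τ * σ ^ 2) * Pw z)) ∂P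
               ≤ ENNReal.ofReal (Real.exp (ε * ((N : ℝ) + 1))))) →
    (∃ σ₀ : ℝ, 0 < σ₀ ∧ ∀ (a₀ θ₀ : ℝ) (u₀ : V3), 0 < a₀ → 0 < θ₀ → ∀ σ : ℝ, 0 < σ → σ < σ₀ →
      ∀ Φ : (N : ℕ) → HardSphereFlow (Torus.geometry (Fin 3)) (hsDiameter σ N) (N + 1),
      ∃ V₀ : ℝ, 0 < V₀ ∧ ∃ β₁ : ℝ, 0 < β₁ ∧ ∀ V : ℝ, V₀ ≤ V → ∀ β : ℝ, 0 < β → β ≤ β₁ →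
        ∀ ε : ℝ, 0 < ε → ∃ τ₀ : ℝ, 0 < τ₀ ∧ ∀ τ : ℝ, τ₀ ≤ τ →
          ∃ N₀ : ℕ, ∀ N : ℕ, N₀ ≤ N →
            (let w : ℝ := τ * ((N : ℝ) + 1) ^ (-(1 / 3 : ℝ))
             let P := localGibbsLaw σ (fun _ => a₀) (fun _ => u₀) (fun _ => θ₀) N (Φ N)
             let actw := fun (i : Fin (N + 1)) (z : Config (N + 1) (Fin 3) T3) =>
               σ / τ * (Φ N).collisionSum (Set.Ioc 0 w)
                 (fun c => if c.fst = i then ‖c.postVel.1 - c.preVel.1‖ else 0) z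
             let cntw := fun (i : Fin (N + 1)) (z : Config (N + 1) (Fin 3) T3) =>
               (Φ N).collisionSum (Set.Ioc 0 w) (fun c => if c.fst = i then (1 : ℝ) else 0) z
             let off := fun (i : Fin (N + 1)) (z : Config (N + 1) (Fin 3) T3) =>
               if actw i z ≤ V ∧ cntw i z ≤ V * τ then (0 : ℝ) else 1
             ∫⁻ z, ENNReal.ofReal (Real.exp (β * ∑ i : Fin (N + 1),
                 off i z * (1 + w⁻¹ * ∫ r in (0 : ℝ)..w, ‖((Φ N).flow r z i).2‖ ^ 2))) ∂P
               ≤ ENNReal.ofReal (Real.exp (ε * ((N : ℝ) + 1))))) →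
    (∃ σ₀ : ℝ, 0 < σ₀ ∧ ∀ (a₀ θ₀ : ℝ) (u₀ : V3), 0 < a₀ → 0 < θ₀ → ∀ σ : ℝ, 0 < σ → σ < σ₀ →
      ∀ Φ : (N : ℕ) → HardSphereFlow (Torus.geometry (Fin 3)) (hsDiameter σ N) (N + 1),
      ∃ V₀ : ℝ, 0 < V₀ ∧ ∀ V : ℝ, V₀ ≤ V → ∃ lam : ℝ, 0 < lam ∧
        ∀ ε : ℝ, 0 < ε → ∃ τ₀ : ℝ, 0 < τ₀ ∧ ∀ τ : ℝ, τ₀ ≤ τ →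
          ∃ N₀ : ℕ, ∀ N : ℕ, N₀ ≤ N →
            (let w : ℝ := τ * ((N : ℝ) + 1) ^ (-(1 / 3 : ℝ))
             let P := localGibbsLaw σ (fun _ => a₀) (fun _ => u₀) (fun _ => θ₀) N (Φ N)
             let act := fun (i : Fin (N + 1)) (t : ℝ) (z : Config (N + 1) (Fin 3) T3) =>
               σ / τ * (Φ N).collisionSum (Set.Ioo 0 t)
                 (fun c => if c.fst = i then ‖c.postVel.1 - c.preVel.1‖ else 0) z
             let cnt := fun (i : Fin (N + 1)) (t : ℝ) (z : Config (N + 1) (Fin 3) T3) =>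
               (Φ N).collisionSum (Set.Ioo 0 t) (fun c => if c.fst = i then (1 : ℝ) else 0) z
             let ω := fun (i : Fin (N + 1)) (t : ℝ) (z : Config (N + 1) (Fin 3) T3) =>
               if act i t z ≤ V ∧ cnt i t z ≤ V * τ then (1 : ℝ) else 0
             let ret := fun (c : HardSphereCollisionRecord (Fin 3) T3 (N + 1))
                 (z : Config (N + 1) (Fin 3) T3) => ω c.fst c.time z * ω c.snd c.time z
             let Ψ := fun (r : ℝ) => (1 + r) * (1 + Real.log (1 + r))
             let nret := fun (i : Fin (N + 1)) (z : Config (N + 1) (Fin 3) T3) =>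
               (Φ N).collisionSum (Set.Ioc 0 w) (fun c => if c.fst = i then 1 - ret c z else 0) z
             let retCharge := fun (i : Fin (N + 1)) (z : Config (N + 1) (Fin 3) T3) =>
               (Φ N).collisionSum (Set.Ioc 0 w)
                 (fun c => if c.fst = i then ret c z * (Ψ ‖c.preVel.1‖ + Ψ ‖c.postVel.1‖) else 0) z
             let Cont := fun (z : Config (N + 1) (Fin 3) T3) =>
               ∑ i : Fin (N + 1), min 1 (nret i z) *
                 (Ψ ‖(z i).2‖ + Ψ ‖((Φ N).flow w z i).2‖ + retCharge i z)
             ∫⁻ z, ENNReal.ofReal (Real.exp (lam / (τ * σ ^ 2) * Cont z)) ∂P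
               ≤ ENNReal.ofReal (Real.exp (ε * ((N : ℝ) + 1))))) →
    ((∃ σ₀ : ℝ, 0 < σ₀ ∧ ∀ (a₀ θ₀ : ℝ) (u₀ : V3), 0 < a₀ → 0 < θ₀ → ∀ σ : ℝ, 0 < σ → σ < σ₀ →
      ∀ Φ : (N : ℕ) → HardSphereFlow (Torus.geometry (Fin 3)) (hsDiameter σ N) (N + 1),
      ∀ C : ℝ, 0 ≤ C →
        ∃ V₀ : ℝ, 0 < V₀ ∧ ∀ V : ℝ, V₀ ≤ V → ∃ β₀ : ℝ, 0 < β₀ ∧ ∀ β : ℝ, |β| ≤ β₀ →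
        ∀ h : T3 → V3 × V3 → V3 × V3 → ℝ,
          Continuous (fun q : T3 × (V3 × V3) × (V3 × V3) => h q.1 q.2.1 q.2.2) →
          (∀ x p p', |h x p p'| ≤
              C * (1 + ‖p.1‖ + ‖p.2‖) * (1 + Real.log (1 + ‖p.1‖ + ‖p.2‖))) →
          (∀ (x : T3) (p : V3 × V3),
            ∫ n, hardSphereKernel p n * h x p (collide n p) ∂sphereMeasure = 0) →
          ∀ ε : ℝ, 0 < ε → ∃ τ₀ : ℝ, 0 < τ₀ ∧ ∀ τ : ℝ, τ₀ ≤ τ → ∃ N₀ : ℕ, ∀ N : ℕ, N₀ ≤ N →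
            (let w : ℝ := τ * ((N : ℝ) + 1) ^ (-(1 / 3 : ℝ))
             let P := localGibbsLaw σ (fun _ => a₀) (fun _ => u₀) (fun _ => θ₀) N (Φ N)
             let act := fun (i : Fin (N + 1)) (t : ℝ) (z : Config (N + 1) (Fin 3) T3) =>
               σ / τ * (Φ N).collisionSum (Set.Ioo 0 t)
                 (fun c => if c.fst = i then ‖c.postVel.1 - c.preVel.1‖ else 0) z
             let cnt := fun (i : Fin (N + 1)) (t : ℝ) (z : Config (N + 1) (Fin 3) T3) =>
               (Φ N).collisionSum (Set.Ioo 0 t) (fun c => if c.fst = i then (1 : ℝ) else 0) z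
             let ω := fun (i : Fin (N + 1)) (t : ℝ) (z : Config (N + 1) (Fin 3) T3) =>
               if act i t z ≤ V ∧ cnt i t z ≤ V * τ then (1 : ℝ) else 0
             let Iw := fun (z : Config (N + 1) (Fin 3) T3) =>
               (Φ N).collisionSum (Set.Ioc 0 w)
                 (fun c => ω c.fst c.time z * ω c.snd c.time z * h c.fstPos c.preVel c.postVel) z
             ∫⁻ z, ENNReal.ofReal (Real.exp (β / (τ * σ ^ 2) * Iw z)) ∂P
               ≤ ENNReal.ofReal (Real.exp (ε * ((N : ℝ) + 1))))) →
    (∃ σ₀ : ℝ, 0 < σ₀ ∧ ∀ (a₀ θ₀ : ℝ) (u₀ : V3), 0 < a₀ → 0 < θ₀ → ∀ σ : ℝ, 0 < σ → σ < σ₀ →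
      ∀ Φ : (N : ℕ) → HardSphereFlow (Torus.geometry (Fin 3)) (hsDiameter σ N) (N + 1),
      ∀ C : ℝ, 0 ≤ C →
        ∃ V₀ : ℝ, 0 < V₀ ∧ ∀ V : ℝ, V₀ ≤ V → ∃ β₀ : ℝ, 0 < β₀ ∧ ∀ β : ℝ, |β| ≤ β₀ →
        ∀ m : T3 → V3 × V3 → ℝ, Continuous (fun q : T3 × (V3 × V3) => m q.1 q.2) →
          (∀ x p, m x p = m x (p.2, p.1)) →
          (∀ x p, |m x p| ≤ C * (1 + ‖p.1‖ + ‖p.2‖)) →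
          ∀ ε : ℝ, 0 < ε → ∃ κ₀ : ℝ, 0 < κ₀ ∧ ∀ κ : ℝ, κ₀ ≤ κ →
            ∃ τ₀ : ℝ, 0 < τ₀ ∧ ∀ τ : ℝ, τ₀ ≤ τ → ∃ N₀ : ℕ, ∀ N : ℕ, N₀ ≤ N →
            (let w : ℝ := τ * ((N : ℝ) + 1) ^ (-(1 / 3 : ℝ))
             let P := localGibbsLaw σ (fun _ => a₀) (fun _ => u₀) (fun _ => θ₀) N (Φ N)
             let act := fun (i : Fin (N + 1)) (t : ℝ) (z : Config (N + 1) (Fin 3) T3) =>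
               σ / τ * (Φ N).collisionSum (Set.Ioo 0 t)
                 (fun c => if c.fst = i then ‖c.postVel.1 - c.preVel.1‖ else 0) z
             let cnt := fun (i : Fin (N + 1)) (t : ℝ) (z : Config (N + 1) (Fin 3) T3) =>
               (Φ N).collisionSum (Set.Ioo 0 t) (fun c => if c.fst = i then (1 : ℝ) else 0) z
             let ω := fun (i : Fin (N + 1)) (t : ℝ) (z : Config (N + 1) (Fin 3) T3) =>
               if act i t z ≤ V ∧ cnt i t z ≤ V * τ then (1 : ℝ) else 0
             let δ : ℝ := κ * ((N : ℝ) + 1) ^ (-(1 / 3 : ℝ))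
             let near := fun (i j : Fin (N + 1)) (r : ℝ) (z : Config (N + 1) (Fin 3) T3) =>
               if j ≠ i ∧ Torus.euclidDist ((Φ N).flow r z i).1 ((Φ N).flow r z j).1 < δ
                 then (1 : ℝ) else 0
             let ηloc := fun (i : Fin (N + 1)) (r : ℝ) (z : Config (N + 1) (Fin 3) T3) =>
               σ ^ 3 / (((N : ℝ) + 1) * (4 / 3 * Real.pi * δ ^ 3)) * ∑ j, near i j r z
             let Y := fun (η : ℝ) =>
               (hsCompressibility (min η (8 * σ ^ 3)) - 1) / (2 / 3 * Real.pi * min η (8 * σ ^ 3))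
             let rate := fun (i : Fin (N + 1)) (r : ℝ) (z : Config (N + 1) (Fin 3) T3) =>
               Y (ηloc i r z) * hsDiameter σ N ^ 2 / (4 / 3 * Real.pi * δ ^ 3) *
                 ∑ j, near i j r z * ω j r z *
                   ((∫ n, hardSphereKernel (((Φ N).flow r z i).2, ((Φ N).flow r z j).2) n
                       ∂sphereMeasure) *
                     m ((Φ N).flow r z i).1 (((Φ N).flow r z i).2, ((Φ N).flow r z j).2))
             let Pw := fun (z : Config (N + 1) (Fin 3) T3) =>
               (Φ N).collisionSum (Set.Ioc 0 w)
                   (fun c => ω c.fst c.time z * ω c.snd c.time z * m c.fstPos c.preVel) z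
                 - ∫ r in (0 : ℝ)..w, ∑ i, ω i r z * rate i r z
             ∫⁻ z, ENNReal.ofReal (Real.exp (β / (τ * σ ^ 2) * Pw z)) ∂P
               ≤ ENNReal.ofReal (Real.exp (ε * ((N : ℝ) + 1))))) →
    (∃ σ₀ : ℝ, 0 < σ₀ ∧ ∀ (a₀ θ₀ : ℝ) (u₀ : V3), 0 < a₀ → 0 < θ₀ → ∀ σ : ℝ, 0 < σ → σ < σ₀ →
      ∀ Φ : (N : ℕ) → HardSphereFlow (Torus.geometry (Fin 3)) (hsDiameter σ N) (N + 1),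
      ∃ V₀ : ℝ, 0 < V₀ ∧ ∃ β₁ : ℝ, 0 < β₁ ∧ ∀ V : ℝ, V₀ ≤ V → ∀ β : ℝ, 0 < β → β ≤ β₁ →
        ∀ ε : ℝ, 0 < ε → ∃ τ₀ : ℝ, 0 < τ₀ ∧ ∀ τ : ℝ, τ₀ ≤ τ →
          ∃ N₀ : ℕ, ∀ N : ℕ, N₀ ≤ N →
            (let w : ℝ := τ * ((N : ℝ) + 1) ^ (-(1 / 3 : ℝ))
             let P := localGibbsLaw σ (fun _ => a₀) (fun _ => u₀) (fun _ => θ₀) N (Φ N)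
             let actw := fun (i : Fin (N + 1)) (z : Config (N + 1) (Fin 3) T3) =>
               σ / τ * (Φ N).collisionSum (Set.Ioc 0 w)
                 (fun c => if c.fst = i then ‖c.postVel.1 - c.preVel.1‖ else 0) z
             let cntw := fun (i : Fin (N + 1)) (z : Config (N + 1) (Fin 3) T3) =>
               (Φ N).collisionSum (Set.Ioc 0 w) (fun c => if c.fst = i then (1 : ℝ) else 0) z
             let off := fun (i : Fin (N + 1)) (z : Config (N + 1) (Fin 3) T3) =>
               if actw i z ≤ V ∧ cntw i z ≤ V * τ then (0 : ℝ) else 1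
             ∫⁻ z, ENNReal.ofReal (Real.exp (β * ∑ i : Fin (N + 1),
                 off i z * (1 + w⁻¹ * ∫ r in (0 : ℝ)..w, ‖((Φ N).flow r z i).2‖ ^ 2))) ∂P
               ≤ ENNReal.ofReal (Real.exp (ε * ((N : ℝ) + 1))))) →
    (∃ σ₀ : ℝ, 0 < σ₀ ∧ ∀ (a₀ θ₀ : ℝ) (u₀ : V3), 0 < a₀ → 0 < θ₀ → ∀ σ : ℝ, 0 < σ → σ < σ₀ →
      ∀ Φ : (N : ℕ) → HardSphereFlow (Torus.geometry (Fin 3)) (hsDiameter σ N) (N + 1),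
      ∃ V₀ : ℝ, 0 < V₀ ∧ ∀ V : ℝ, V₀ ≤ V → ∃ lam : ℝ, 0 < lam ∧
        ∀ ε : ℝ, 0 < ε → ∃ τ₀ : ℝ, 0 < τ₀ ∧ ∀ τ : ℝ, τ₀ ≤ τ →
          ∃ N₀ : ℕ, ∀ N : ℕ, N₀ ≤ N →
            (let w : ℝ := τ * ((N : ℝ) + 1) ^ (-(1 / 3 : ℝ))
             let P := localGibbsLaw σ (fun _ => a₀) (fun _ => u₀) (fun _ => θ₀) N (Φ N)
             let act := fun (i : Fin (N + 1)) (t : ℝ) (z : Config (N + 1) (Fin 3) T3) =>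
               σ / τ * (Φ N).collisionSum (Set.Ioo 0 t)
                 (fun c => if c.fst = i then ‖c.postVel.1 - c.preVel.1‖ else 0) z
             let cnt := fun (i : Fin (N + 1)) (t : ℝ) (z : Config (N + 1) (Fin 3) T3) =>
               (Φ N).collisionSum (Set.Ioo 0 t) (fun c => if c.fst = i then (1 : ℝ) else 0) z
             let ω := fun (i : Fin (N + 1)) (t : ℝ) (z : Config (N + 1) (Fin 3) T3) =>
               if act i t z ≤ V ∧ cnt i t z ≤ V * τ then (1 : ℝ) else 0
             let ret := fun (c : HardSphereCollisionRecord (Fin 3) T3 (N + 1))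
                 (z : Config (N + 1) (Fin 3) T3) => ω c.fst c.time z * ω c.snd c.time z
             let Ψ := fun (r : ℝ) => (1 + r) * (1 + Real.log (1 + r))
             let nret := fun (i : Fin (N + 1)) (z : Config (N + 1) (Fin 3) T3) =>
               (Φ N).collisionSum (Set.Ioc 0 w) (fun c => if c.fst = i then 1 - ret c z else 0) z
             let retCharge := fun (i : Fin (N + 1)) (z : Config (N + 1) (Fin 3) T3) =>
               (Φ N).collisionSum (Set.Ioc 0 w)
                 (fun c => if c.fst = i then ret c z * (Ψ ‖c.preVel.1‖ + Ψ ‖c.postVel.1‖) else 0) z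
             let Cont := fun (z : Config (N + 1) (Fin 3) T3) =>
               ∑ i : Fin (N + 1), min 1 (nret i z) *
                 (Ψ ‖(z i).2‖ + Ψ ‖((Φ N).flow w z i).2‖ + retCharge i z)
             ∫⁻ z, ENNReal.ofReal (Real.exp (lam / (τ * σ ^ 2) * Cont z)) ∂P
               ≤ ENNReal.ofReal (Real.exp (ε * ((N : ℝ) + 1))))) →
    (∃ σ₀ : ℝ, 0 < σ₀ ∧ ∀ (a₀ θ₀ : ℝ) (u₀ : V3), 0 < a₀ → 0 < θ₀ → ∀ σ : ℝ, 0 < σ → σ < σ₀ →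
      ∀ Φ : (N : ℕ) → HardSphereFlow (Torus.geometry (Fin 3)) (hsDiameter σ N) (N + 1),
      ∀ C' : ℝ, 0 ≤ C' → ∃ β₁ : ℝ, 0 < β₁ ∧
      ∀ G : T3 × V3 → ℝ, Continuous G → (∀ y, |G y| ≤ C' * (1 + ‖y.2‖ ^ 2)) →
      (∃ R : ℝ, ∀ y : T3 × V3, R ≤ ‖y.2‖ → G y = 0) →
      (∃ L' : ℝ, (∀ x v v', |G (x, v) - G (x, v')| ≤ L' * ‖v - v'‖ * (1 + ‖v‖ + ‖v'‖)) ∧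
        (∀ x x' v, |G (x, v) - G (x', v)| ≤ L' * (1 + ‖v‖ ^ 2) * dist x x')) →
      (∀ x, ∫ v, G (x, v) * localMaxwellian 1 θ₀ u₀ v = 0) →
      (∀ x (j : Fin 3), ∫ v, G (x, v) * v j * localMaxwellian 1 θ₀ u₀ v = 0) →
      (∀ x, ∫ v, G (x, v) * ‖v‖ ^ 2 * localMaxwellian 1 θ₀ u₀ v = 0) →
      ∀ β : ℝ, |β| ≤ β₁ → ∀ ε : ℝ, 0 < ε → ∃ τ : ℝ, 0 < τ ∧ ∃ N₀ : ℕ, ∀ N : ℕ, N₀ ≤ N →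
        ∫⁻ z, ENNReal.ofReal (Real.exp (β * ∑ i : Fin (N + 1),
            (τ * ((N : ℝ) + 1) ^ (-(1 / 3 : ℝ)))⁻¹ *
              ∫ r in (0 : ℝ)..(τ * ((N : ℝ) + 1) ^ (-(1 / 3 : ℝ))), G (((Φ N).flow r z) i)))
          ∂(localGibbsLaw σ (fun _ => a₀) (fun _ => u₀) (fun _ => θ₀) N (Φ N)) ≤
          ENNReal.ofReal (Real.exp (ε * ((N : ℝ) + 1))))) →
    ((∃ σ₀ : ℝ, 0 < σ₀ ∧ ∀ (a₀ θ₀ : ℝ) (u₀ : V3), 0 < a₀ → 0 < θ₀ → ∀ σ : ℝ, 0 < σ → σ < σ₀ →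
      ∀ Φ : (N : ℕ) → HardSphereFlow (Torus.geometry (Fin 3)) (hsDiameter σ N) (N + 1),
      ∀ C' : ℝ, 0 ≤ C' → ∃ β₁ : ℝ, 0 < β₁ ∧
      ∀ G : T3 × V3 → ℝ, Continuous G → (∀ y, |G y| ≤ C' * (1 + ‖y.2‖ ^ 2)) →
      (∃ R : ℝ, ∀ y : T3 × V3, R ≤ ‖y.2‖ → G y = 0) →
      (∃ L' : ℝ, (∀ x v v', |G (x, v) - G (x, v')| ≤ L' * ‖v - v'‖ * (1 + ‖v‖ + ‖v'‖)) ∧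
        (∀ x x' v, |G (x, v) - G (x', v)| ≤ L' * (1 + ‖v‖ ^ 2) * dist x x')) →
      (∀ x, ∫ v, G (x, v) * localMaxwellian 1 θ₀ u₀ v = 0) →
      (∀ x (j : Fin 3), ∫ v, G (x, v) * v j * localMaxwellian 1 θ₀ u₀ v = 0) →
      (∀ x, ∫ v, G (x, v) * ‖v‖ ^ 2 * localMaxwellian 1 θ₀ u₀ v = 0) →
      ∀ β : ℝ, |β| ≤ β₁ → ∀ ε : ℝ, 0 < ε → ∃ τ : ℝ, 0 < τ ∧ ∃ N₀ : ℕ, ∀ N : ℕ, N₀ ≤ N →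
        ∫⁻ z, ENNReal.ofReal (Real.exp (β * ∑ i : Fin (N + 1),
            (τ * ((N : ℝ) + 1) ^ (-(1 / 3 : ℝ)))⁻¹ *
              ∫ r in (0 : ℝ)..(τ * ((N : ℝ) + 1) ^ (-(1 / 3 : ℝ))), G (((Φ N).flow r z) i)))
          ∂(localGibbsLaw σ (fun _ => a₀) (fun _ => u₀) (fun _ => θ₀) N (Φ N)) ≤
          ENNReal.ofReal (Real.exp (ε * ((N : ℝ) + 1)))) →
    (∃ σ₀ : ℝ, 0 < σ₀ ∧ ∀ (a₀ θ₀ : ℝ) (u₀ : V3), 0 < a₀ → 0 < θ₀ → ∀ σ : ℝ, 0 < σ → σ < σ₀ →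
      ∀ Φ : (N : ℕ) → HardSphereFlow (Torus.geometry (Fin 3)) (hsDiameter σ N) (N + 1),
      ∀ C' : ℝ, 0 ≤ C' → ∃ β₁ : ℝ, 0 < β₁ ∧
      ∀ G : T3 × V3 → ℝ, Continuous G → (∀ y, |G y| ≤ C' * (1 + ‖y.2‖ ^ 2)) →
      (∃ R : ℝ, ∀ y : T3 × V3, R ≤ ‖y.2‖ → G y = 0) →
      (∀ x, ∫ v, G (x, v) * localMaxwellian 1 θ₀ u₀ v = 0) →
      (∀ x (j : Fin 3), ∫ v, G (x, v) * v j * localMaxwellian 1 θ₀ u₀ v = 0) →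
      (∀ x, ∫ v, G (x, v) * ‖v‖ ^ 2 * localMaxwellian 1 θ₀ u₀ v = 0) →
      ∀ β : ℝ, |β| ≤ β₁ → ∀ ε : ℝ, 0 < ε → ∃ τ : ℝ, 0 < τ ∧ ∃ N₀ : ℕ, ∀ N : ℕ, N₀ ≤ N →
        ∫⁻ z, ENNReal.ofReal (Real.exp (β * ∑ i : Fin (N + 1),
            (τ * ((N : ℝ) + 1) ^ (-(1 / 3 : ℝ)))⁻¹ *
              ∫ r in (0 : ℝ)..(τ * ((N : ℝ) + 1) ^ (-(1 / 3 : ℝ))), G (((Φ N).flow r z) i)))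
          ∂(localGibbsLaw σ (fun _ => a₀) (fun _ => u₀) (fun _ => θ₀) N (Φ N)) ≤
          ENNReal.ofReal (Real.exp (ε * ((N : ℝ) + 1))))) →
    Summit.AtomisticToContinuum.HydrodynamicLimit.Theses.TwoClocks.EquilibriumFastWindowLD :=
  fun h₁ h₂ h₃ h₄ hT hL => EquilibriumFastWindowLD_of_boundedWindowLD (hL (hT h₁ h₂ h₃ h₄))

end Summit.AtomisticToContinuum.HydrodynamicLimit.Cruxes.EquilibriumFastWindowLD.Birth

end
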